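import Summits.MatrixMultiplication.MatrixMultiplication.Theses.LevelGradedCohnUmans
import Summits.MatrixMultiplication.MatrixMultiplication.Theorems.LevelGradedCohnUmansSnLevelDesignsStubGarnirVanishing
import Summits.MatrixMultiplication.MatrixMultiplication.Theorems.LevelGradedCohnUmansSnLevelDesignsStubDecreasingCover
import Summits.MatrixMultiplication.MatrixMultiplication.Theorems.LevelGradedCohnUmansSnLevelDesignsStubBlockDescent
import Summits.MatrixMultiplication.MatrixMultiplication.Theorems.LevelGradedCohnUmansSnLevelDesignsStubShellInterpolation
import Summits.MatrixMultiplication.MatrixMultiplication.Theorems.LevelGradedCohnUmansSnLevelDesignsStubFirstRowHooks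
import Summits.MatrixMultiplication.MatrixMultiplication.Theorems.LevelGradedCohnUmansSnLevelDesignsStubHookGlue
import Summits.MatrixMultiplication.MatrixMultiplication.Theorems.LevelGradedCohnUmansSnLevelDesignsStubNearWallGlue
import Summits.MatrixMultiplication.MatrixMultiplication.Theorems.LevelGradedCohnUmansSnLevelDesignsStubTopCone
import Summits.MatrixMultiplication.MatrixMultiplication.Theorems.LevelGradedCohnUmansSnLevelDesignsStubUniformJuntaWall
import Summits.MatrixMultiplication.MatrixMultiplication.Theorems.LevelGradedCohnUmansSnLevelDesignsStubHostedMiddleWall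
import Summits.MatrixMultiplication.MatrixMultiplication.Theorems.LevelGradedCohnUmansSnLevelDesignsStubXzIndependence
import Summits.MatrixMultiplication.MatrixMultiplication.Theorems.LevelGradedCohnUmansSnLevelDesignsStubTwoSetCore
-- import Summits.MatrixMultiplication.MatrixMultiplication.Theorems.LevelGradedCohnUmansSnLevelDesignsStubHubPairs
--   (LANDED p110856; farm snapshot has not built this module yet — `stub_hubPairs` is re-sorried below until it has)
-- import Summits.MatrixMultiplication.MatrixMultiplication.Theorems.LevelGradedCohnUmansSnLevelDesignsStubHubTriples
--   (LANDED p112737; farm snapshot has not built this module yet — `stub_hubTriples` is re-sorried below until it has)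
import Summits.MatrixMultiplication.MatrixMultiplication.Theorems.LevelGradedCohnUmansSnLevelDesignsStubFloatingFrameCount
-- import Summits.MatrixMultiplication.MatrixMultiplication.Theorems.LevelGradedCohnUmansSnLevelDesignsStubAlphabetWall
--   (LANDED p117603; imported as soon as the farm snapshot has built the module — `stub_alphabetWall` is re-sorried below until then)
-- import Summits.MatrixMultiplication.MatrixMultiplication.Theorems.LevelGradedCohnUmansSnLevelDesignsStubFullBudgetTransfer
--   (LANDED p117355; same)
-- import Summits.MatrixMultiplication.MatrixMultiplication.Theorems.LevelGradedCohnUmansSnLevelDesignsStubLinearCriterion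
--   (LANDED (proposal pending); imported as soon as the farm snapshot has built the module — `stub_linearCriterion` is re-sorried below until then)
-- import Summits.MatrixMultiplication.MatrixMultiplication.Theorems.LevelGradedCohnUmansSnLevelDesignsStubMiddleIdentityTest
--   (LANDED p116594; imported as soon as the farm snapshot has built the module — `stub_middleIdentityTest` is re-sorried below until then)
-- import Summits.MatrixMultiplication.MatrixMultiplication.Theorems.LevelGradedCohnUmansSnLevelDesignsStubGarnirFreeMiddle
--   (LANDED p116407; imported as soon as the farm snapshot has built the module — `stub_garnirFreeMiddle` is re-sorried below until then)
import Summits.MatrixMultiplication.MatrixMultiplication.Theorems.SnLevelDesigns.Negative.DimensionWalls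
import Summits.MatrixMultiplication.MatrixMultiplication.Theorems.LevelGradedCohnUmansTokenWall
import HarnessLib.Audit

/-!
# Line `garnir-annihilator` — crux `LevelGradedCohnUmans.SnLevelDesigns` (stmt-MatrixMultiplication-7613)

LEAD RESHAPE (prover-line-stmt-MatrixMultiplication-7613-0, 2026-08-16): (i) S3 `BlockDescent` now asserts
`bruhatLE (p*σ) p ∧ posWeight p < posWeight (p*σ)` with the position weight `Φ(w) = Σ i·w(i)` instead of the
inversion count (one-swap computation instead of inversion combinatorics; the straightening induction below runs on
`n³ - Φ`); (ii) S5 `EpsilonGlue` is split into S5h `FirstRowHooks` (first-row hook peeling: `f^μ ≤ C(n,j)·D(j)` and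
`levelDim n k ≥ e^{-2} C(n,k)² k!` for `3k ≤ n`) and S5g `HookGlue : FirstRowHooks → EpsilonGlue` (Vershik–Kerov
analysis + rpow transfer). Seven registered stubs: S1 S2 S3 S4 S5h S5g S6; `SnLevelDesigns_of` unchanged in shape.

LEAD RESHAPE 2 (same seat, after wave 1 and `NegativeNotes-…-drefute-g3.md`): S1 S2 S3 S4 S5h S5g are LANDED
(p79352 p79809 p80268 p78590 p83778 p77815; Literature FirstRowPeeling p80617) and imported; the fixed-shell certificate
is generalised to FLOATING frames (`FloatingCertified`, `separated_of_floatingCertified`, via `tokenFn_translate`) —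
which voids the refuter's shell-packing obstruction SF — and the planner gen-2 NearWall wall clause (`e^{δ√k}` slack,
`3k ≤ n`) is adopted: open stubs are now S5g' `stub_nearWallGlue` (provable now) and S6' `stub_floatingGarnirDesigns`
(the construction); the `example (h₆ : GarnirDesigns)` records that the gen-1 target already closes the crux outright.

LEAD c1 RESHAPE 3 (prover-line-stmt-MatrixMultiplication-7613-c1-0, continuation seat, 2026-08-16): the seven landed stubs
are IMPORTED (this is the import version of the skeleton; one construction sorry S6'), and the JUNTA SUB-CERTIFICATE is made
explicit. Observation: for the Bruhat-TOP shell element `sTop n j = [j, j+1, …, n-1 | j-1, …, 0]` (`lis = n-j`) the upper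
Bruhat cone `{q : sTop ≤_B q}` is the single `j`-coset `{q : q (n-j+i) = j-1-i}` (registered stub J1 `stub_topCone`, pure
rank-matrix counting, LANDED p97827), so its dual functional is a COSET INDICATOR and every JUNTA-separated triple (`JuntaSeparated`: each
target `t` is told apart from all of its garbage by the restriction to ONE frame `ι : Fin k → Fin n`, chosen per target) is
floating-Garnir-certified of depth 0 (`floatingCertified_of_juntaSeparated`, constructor `incomparable` only) — and of
course `k`-token separated directly (`separated_of_juntaSeparated`, the coset indicator is a token function). Hence
`NearWall JuntaSeparated → FloatingDesigns → SnLevelDesigns` (`floatingDesigns_of_juntaDesigns`,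
`crux_of_juntaDesigns`): the registered construction stub S6' CONTAINS the linear-algebra-free, straightening-free
core common to all three lines (junta ⊆ fixed-set-certified ⊆ separated; junta ⊆ shield ⊆ Garnir ⊆ floating Garnir).
Registered stub J2 `stub_uniformJuntaWall` (LANDED p98831) records why the junta frame must FLOAT with the target: one frame serving all
targets forces `|X|·|Z| ≤ n^k` (`≪ D_k ≈ n^{2k}/k!`). Open: S6' (held by the lead; sub-target NearWall JuntaSeparated).
LEAD c1 RESHAPE 4 (same seat): registered stub J3 `stub_hostedMiddleWall` (LANDED p106533) — the route's AGL-hosted middle set is dead for the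
junta certificate by `√(k!)`: if `YY⁻¹` covers a subgroup `G` transitive on the `k`-frames with trivial pointwise stabiliser
(e.g. `AGL_d(𝔽_q)`, `k = d+1`) then `|X||Z| ≤ C(n,k)²`, whence `V ≤ C(n,k)·D_k ≤ e·D_k^{3/2}/√(k!)`.
LEAD c2 RESHAPE 5 (prover-line-stmt-MatrixMultiplication-7613-c2-0, continuation seat 2, 2026-08-16): the ten landed stubs are
IMPORTED (one open sorry, S6'), and the TWO-SET CORE of the construction is registered; ALL FIVE new stubs of this reshape LANDED in
cycle 1 (K1 p109071, K2 p109797, J4 p110007, K3 p110856, K4 p112737 — sorried here only until the farm snapshot builds their modules). K2 `stub_twoSetCore` (provable now, walls +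
arithmetic): collapsing `Y` (`y = y'`) in ANY near-wall family of separated triples leaves pairs `(X, Z)` separated with middle set
`{1}` — i.e. `X⁻¹Z` injective and INDEPENDENT in the level-`k` token matroid (K1 `stub_xzIndependence`, the exact linear-algebra
form) — with `D_k ≤ e^{δ√k}|X||Z|` and `|X|, |Z| ≤ e^{δ√k}√D_k` (`NearWallPair`): a Y-free, certificate-free necessary condition
shared by all three lines. J4 `stub_floatingFrameCount` (provable now): in a junta design the frame must float in BOTH coordinates —
for each fixed `x₀`, `|Y|·|Z| ≤ #{frames used at x₀}·n^k` (so `≳ C(n,k)e^{-δ√k}` distinct frames per `x₀`), and the label form of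
J2, `|X|·|Z| ≤ #{frames}·n^k`. K3 `stub_hubPairs` (provable now): the explicit baseline — hub-gadget pairs in `𝔖_{2m+k}` with
`|X||Z| = C(m,k)(m)_k ≈ 4^{-k}Λ_k`, XZ-junta with the floating frame `b⁰`; K4 `stub_hubTriples` (provable now): TRANSFER — every TPP triple of pattern classes in
`𝔖_k` gives junta-separated TRIPLES in `𝔖_{3m+k}` with `V = C(m,k)³|P₁||P₂||P₃| ≤ 27^{-k}D_k^{3/2}`. Lead's analysis of S6' through the core (NOTES / crux note `TwoSetCore-c2.md`): `k`-identifiable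
SETS of size `Λ_k(1-O(k²/n))`, `Λ_k = C(n,k)(n)_k`, exist (hub families `Π_i (b_i a_i h_i)`), so junta is not lossy at the set
level; for PRODUCT sets the hub gadget meets exactly one obstruction (same-index letter cancellations `a_i = b_i` are invisible in
`x⁻¹z` and create TPP partners) whose known exclusions cost `e^{-Θ(√(k log n))}` — short of NearWall by `√log`, far above every
construction on record (`0.25^k … 0.83^k`).

Skeleton (crux-plan, round 1; idea card `Cruxes/SnLevelDesigns/Ideas/garnir-annihilator.md`, triage
`TRIAGE-r1-{1,2,3}`: pass × 3 "as a two-sided TOOL … should ride with the RSS/KL line, annihilator side";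
this file turns the tool into a CONCLUDING line whose distinctive half is the annihilator-side straightening).

CRUX (by name): `Summit.MatrixMultiplication.MatrixMultiplication.Theses.LevelGradedCohnUmans.SnLevelDesigns` —
`∀ ε > 0 ∃ n k X Y Z ⊆ 𝔖ₙ`, `k`-token separated (tests `g ↦ Σ_{p : [k] → [n]} c p (g ∘ p)`), with
`Σ_{μ ⊢ n, μ₁ ≥ n-k} (f^μ)^{2+ε} < (|X||Y||Z|)^{(2+ε)/3}`.

THE LINE (annihilator side of the level-`k` algebra `A_k = ℂ𝔖ₙ / J_k^⊥`, `J_k^⊥ = T_k^⊥` the annihilator of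
the `k`-token space). Card lever: `J_k^⊥` is the two-sided ideal generated by the Young antisymmetrizers
`ε_B = Π_i Σ_{σ ∈ Sym(B_i)} sgn(σ) σ` of block systems `B` of EXCESS `Σ_i (|B_i| - 1) ≥ k + 1` ("Garnir cosets").
A block system is rendered as a labelling `blk : Fin n → Fin n` (blocks = fibres; `numBlocks` = number of labels
used; excess `= n - numBlocks`); its Young subgroup is the finset `blockStab blk = {σ | blk ∘ σ = blk}`.
* S1 `stub_garnirVanishing` — THE LEVER (size S–M): for every block labelling of excess `≥ k+1`, every token table
  `c` and all `a b ∈ 𝔖ₙ`, `Σ_{σ ∈ blockStab blk} sgn(σ) · f_c(a σ b) = 0` — i.e. `sgn · 1_{a·S_B·b} ∈ T_k^⊥`.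
  Proof = the card's pigeonhole: a `k`-tuple `b ∘ p` misses two points of one block, right multiplication by their
  transposition preserves the fibre `{(aσb) ∘ p = r}` and flips the sign. Generalises `Disproof.sum_coset_sign_mul_
  tokenFn` (cubes `(ℤ/2)^{k+1}`) and `Disproof.sum_sign_mul_tokenFn` (one block `[n]`) to every shape.
* S2 `stub_decreasingCover` (size M; Greene–Mirsky dual of Schensted): a permutation with NO increasing subsequence
  of length `n - k` (i.e. outside the Schensted shell `B_k = {lis ≥ n-k}`) is strictly decreasing on the blocks of
  some labelling with `≤ n-k-1` blocks (patience levels: `blk a =` length of the longest increasing subsequence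
  ending at `a`), hence carries an ADMISSIBLE Garnir system (`Admissible`: excess `≥ k+1` and block-decreasing).
* S3 `stub_blockDescent` (size M): if `p` is decreasing on the blocks of `blk` then every proper rearrangement
  `p σ`, `σ ∈ blockStab blk ∖ 1`, lies BELOW `p` in the (rank-matrix) Bruhat order and has fewer inversions
  (`p` places the largest values of each block earliest: a block-by-block count of the rank matrices; `p` is the
  longest element of its coset `p·S_B`).
  S1–S3 give GARNIR STRAIGHTENING, proved below from the stubs (`tokenFn_eq_zero_of_not_bruhatLE`): modulo `J_k^⊥`
  every `p ∉ B_k` is a signed sum of the other members of an admissible Garnir coset, all Bruhat-below `p`; by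
  induction on inversions every `p` straightens onto shell elements Bruhat-below it — the `ShadowStraightening`
  that cards kl-schensted-certificate / lis-bruhat-shield take from Kazhdan–Lusztig cell theory (RSS 2009 + KL 1979),
  here ELEMENTARY (no KL basis, no cells, no RSK), and with the observed sign/product structure of the coefficients
  (kl card: 87 % of straightening coefficients are ±1 — iterated signed coset relations produce exactly that).
* S4 `stub_shellInterpolation` (size L; Raghavan–Samuel–Subrahmanyam 2009 Thm 2 at `λ = (n-k,1^k)`, guard `k ≤ n`
  — triage r1-3's correction of the card's `stub_shell_interpolating`): every function on the Schensted shell is the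
  restriction of a `k`-token function (the shell is independent in `A_k`; with S1–S3's spanning this is the count
  `#B_k = Σ_{μ₁ ≥ n-k} (f^μ)² = dim T_k`: Schensted 1961 + EFP 2011 Thm 7, `EllisFriedgutPilpel2011_thm7_holds`).
  Numerically certain (three independent exact checks, n ≤ 8; kit j008490, j010256, j010362).
* S5 `stub_epsilonGlue` (size M; the merged poly-slack-transfer / classical-sandwich ε-bookkeeping, triage: "land as
  the shared support glue of the constructive line"): for ANY property `P` of level-`k` triples, a family with
  `D_k(n)^{3/2} ≤ k^C · |X||Y||Z|`, `n ≥ k³`, along `k → ∞` contains, for every `ε > 0`, a member satisfying the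
  crux's budget inequality — Vershik–Kerov upper bound (`VershikKerov1985_maxCharDegree_holds`, PROVED in tree) +
  hook-length peeling `f_{(n-j,ν)} ≤ C(n,j) f_ν`. Uniform in `P`, so it is glue, not a restatement.
* S6 `stub_garnirDesigns` — THE CLOSER (hardest; the line's Transfer `C⁺`, open): along `k → ∞` (`n ≥ k³`) there
  are triples `X, Y, Z ⊆ 𝔖ₙ` within `k^C` of the wall (`D_k^{3/2} ≤ k^C |X||Y||Z|`) that are GARNIR-CERTIFIED:
  `k ≤ n`, targets `x⁻¹z` in the shell, and for every target `t` every non-target quadruple product `p` lies in the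
  inductive GARNIR-AVOIDANCE set `GarnirAvoid n k t` — generated by (shell) `p ∈ B_k, p ≠ t`; (incomparable)
  `t ≰_B p`; (step) ALL proper rearrangements `p σ`, `σ ∈ blockStab blk ∖ 1`, of `p` under SOME block labelling of
  excess `≥ k+1` (any shape, decreasing or not — the designer's choice) avoid `t`. This contains the Bruhat-shadow
  certificate `ShadowTPP` of the KL line as the sub-case "shell ∪ incomparable" and is strictly more permissive
  (kl card's census: true straightening supports are ≈ half the Bruhat shadow), LA-free, and tolerant to poly(k)
  losses; it is still the crux's construction problem and carries all of its difficulty — honestly named, not hidden.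
  TOY EVIDENCE (this seat, `compute/toy_garnir.py`, exact arithmetic; kit j010715, j010717, j010760, summaries on the
  item): writing `c_{p,t}` for the straightening coefficient of `p` on the shell element `t` (`= f_t(p)`), the
  certificates are SOUND (0 certified pairs with `c_{p,t} ≠ 0` at every depth) and their reach among the pairs
  `(t, p ∉ B_k)` with `c_{p,t} = 0`, for trees of depth ≤ 0 (= Bruhat shadow) / 1 / 2 / 3 / 4 / 5, is
  `(4,1)`: 54/88/100 %; `(5,1)`: 55/70/90/99.6/99.8/99.8 % (closure reached: 2 of 1 100 zeros are pure cancellations);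
  `(5,2)`: 60/84/99/100 %; `(6,1)`: 52/58/72/91/99.5/99.8 %; `(6,2)`: 66/74/87/97/99.3/99.7 %; `(6,3)`:
  63/80/94/99.1/99.8/99.9 % — the avoidance certificate all but DECIDES `c_{p,t} = 0`, the Bruhat shadow sees half.
  The same runs re-verify S1 (0 violations over all set partitions of excess ≥ k+1), S2/S3 (0 violations, 69 000
  block rearrangements) and S4 (`rank = #B_k = dim T_k = 10, 17, 78, 26, 207, 588`).
The composition `SnLevelDesigns_of : S1 → S2 → S3 → S4 → S5 → S6 → SnLevelDesigns` is PROVED below: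
S4 gives the dual functional `f_t` of a target (`= δ_t` on the shell); S1 kills `f_t` on every `step` node whose
children it kills; S1+S2+S3 kill it on `{p : t ≰_B p}` (induction on inversions); so `f_t` vanishes on
`GarnirAvoid n k t ∋` every non-target product and equals `1` at the target: the crux's separation clause verbatim
(`separated_of_certified`); S5 at `P := GarnirCertified` fed with S6 supplies `(n,k,X,Y,Z)` and the budget clause.
Also proved here from S1 alone (the card's design-side KILL-TEST, necessary direction): if `Y ⊇ y₁·blockStab blk`
for one labelling of excess `≥ k+1` (e.g. `Y` contains a coset of `Sym` of `k+2` points, or of `k+1` disjoint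
transpositions) and `X, Z ≠ ∅`, then `(X,Y,Z)` is NOT `k`-token separated (`not_separated_of_coset_subset`).

DISPROOF USED (`Cruxes/SnLevelDesigns/Disproof.lean`, cdisprove v3 2026-08-16T02:07Z, VERDICT: NO KILL; no
`_false_without_` theorem exists for this crux; landed Negative lemmas `Theorems/SnLevelDesigns/Negative/
{CoveringWall,DimensionWalls,DeadCorners}.lean` are consequences of separation and are honoured automatically since
the line CONCLUDES the separation clause verbatim and never weakens it):
* LOAD-BEARING clauses `exists_budget_lt_volPow` (separation) / `at_le_version_trivial` (strict `<`): honoured —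
  `separated_of_certified` produces `Sep` itself; S5/S6 keep the strict inequality of the crux.
* `not_at_level_zero`, `not_at_level_one` (levels 0, 1 dead), graded Neumann count `volume_le_of_cubic_budget`
  (every fixed level dies as `ε → 0`, `k(ε) ≳ 6/ε`): honoured by the SHAPE of S6 (`∀ k₀ ∃ k ≥ k₀`, `n ≥ k³`): the
  line never bets on a fixed level; the sibling refutation `LevelGradedCohnUmansLevelTwoBeatsCubes_refuted`
  (negatives index) is a fixed-level statement and is not restated.
* COSET OBSTRUCTION `exists_coset_point_not_mem_quot` / `sum_coset_sign_mul_tokenFn`: S1 is its generalisation to all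
  block shapes; the kill-test below is its design-side form; and `GarnirAvoid` can never certify a product set
  containing a full Garnir coset through a target (S1 would force `f_t(t) = 0 ≠ 1`) — consistent.
* GENERAL FORM paragraph (separated ⇔ TPP' ∧ targets ∉ supports of `T_k^⊥ ∩ ℂ^Q`): this line is its constructive
  half — a Garnir-avoidance tree is an explicit witness that `δ_t|_Q ∈ T_k|_Q`.
Dead lines: none recorded on the item (round 1). Negatives index (`ledger negatives --problem
MatrixMultiplication`): ExactLineDesign / ExactFrameDesign / SeparableDesignsMultiplicative / LevelTwoBeatsCubes —
none restated (no fixed level, no finite-field frame, no Kronecker flattening here).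

Namespace `…Cruxes.SnLevelDesigns.GarnirAnnihilator`. Conventions as in the accepted skeletons (e.g.
`CriticalPhenomena/…/StableConeRPRigidity/Lines/cross-theorem-analyticity.lean`): each stub statement is a plain
`def … : Prop`; the REGISTERED stubs are the sorried `theorem stub_…` (statement unfolded one level); the name-keyed
aliases `Registered.stub_…` are the hypotheses of `SnLevelDesigns_of`. Vocabulary (`schenstedSet`, `bruhatLE`,
`KTokenSeparated`) is copied VERBATIM from `Ideator3Sketch.lean` (kl-schensted-certificate) so the two lines'
statements are syntactically interchangeable.
-/

set_option linter.dupNamespace false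

noncomputable section

namespace Summit.MatrixMultiplication.MatrixMultiplication.Cruxes.SnLevelDesigns.GarnirAnnihilator

open scoped BigOperators
open Literature.NumberTheory.DiophantineGeometry (numStandardTableaux)

variable {n : ℕ}

/-! ## Vocabulary (elementary; no submodules) -/

/-- The `k`-token test functional with coefficient table `c`: `g ↦ Σ_{p : [k] → [n]} c p (g ∘ p)` (verbatim the
crux's test functions; `= Disproof.tokenFn`). -/
def tokenFn {n k : ℕ} (c : (Fin k → Fin n) → (Fin k → Fin n) → ℂ) (g : Equiv.Perm (Fin n)) : ℂ :=
  ∑ p : Fin k → Fin n, c p (⇑g ∘ p)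

/-- The crux's separation clause, verbatim (first conjunct of `SnLevelDesigns` at fixed `n, k`; `= Disproof.Sep`,
`= Ideator3.KTokenSeparated`). -/
def KTokenSeparated (n k : ℕ) (X Y Z : Finset (Equiv.Perm (Fin n))) : Prop :=
  ∀ x₀ ∈ X, ∀ z₀ ∈ Z, ∃ c : (Fin k → Fin n) → (Fin k → Fin n) → ℂ,
    ∀ x ∈ X, ∀ y ∈ Y, ∀ y' ∈ Y, ∀ z ∈ Z,
      (∑ p : Fin k → Fin n, c p (⇑(x⁻¹ * y * y'⁻¹ * z) ∘ p)) =
        if x = x₀ ∧ y = y' ∧ z = z₀ then 1 else 0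

/-- `g` has an increasing subsequence of length `≥ m` (verbatim `Ideator3.HasIncSubseq`). -/
def HasIncSubseq (g : Equiv.Perm (Fin n)) (m : ℕ) : Prop :=
  ∃ s : Finset (Fin n), m ≤ s.card ∧ StrictMonoOn (⇑g) (s : Set (Fin n))

/-- The **Schensted shell** `B_k(n) = {g ∈ 𝔖ₙ : lis(g) ≥ n - k}` (verbatim `Ideator3.schenstedSet`);
`#B_k = Σ_{μ₁ ≥ n-k} (f^μ)²` (Schensted 1961) `= dim T_k` (EFP 2011 Thm 7). -/
def schenstedSet (n k : ℕ) : Set (Equiv.Perm (Fin n)) := {g | HasIncSubseq g (n - k)}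

/-- (Strong) Bruhat order on `𝔖ₙ` by the rank-matrix criterion (Björner–Brenti Thm 2.1.5; verbatim
`Ideator3.bruhatLE`, identity at the bottom): `v ≤ w` iff for all `i, j`, `#{a < i : v(a) < j} ≥ #{a < i : w(a) < j}`. -/
def bruhatLE (v w : Equiv.Perm (Fin n)) : Prop :=
  ∀ i j : ℕ,
    (Finset.univ.filter (fun a : Fin n => (a : ℕ) < i ∧ ((w a : Fin n) : ℕ) < j)).card ≤
      (Finset.univ.filter (fun a : Fin n => (a : ℕ) < i ∧ ((v a : Fin n) : ℕ) < j)).card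

/-- The POSITION WEIGHT `Φ(w) = Σ_i i · w(i)` of a permutation (LEAD RESHAPE, replaces the inversion count as the
straightening measure): sorting an inverted pair of positions strictly increases it, un-sorting strictly decreases it
(`Φ(w ∘ swap a b) - Φ(w) = (b - a)(w a - w b)`), so a block-decreasing `p` is the unique `Φ`-minimum of its
block coset and an `S`-increasing `b` is the unique `Φ`-maximum of its `T`-coset (rearrangement inequality). -/
def posWeight (w : Equiv.Perm (Fin n)) : ℕ :=
  ∑ i : Fin n, (i : ℕ) * ((w i : Fin n) : ℕ)

/-- The Young subgroup of a block labelling `blk` (blocks = fibres of `blk`), as a finset: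
`{σ | blk (σ a) = blk a for all a}`. -/
def blockStab (blk : Fin n → Fin n) : Finset (Equiv.Perm (Fin n)) :=
  Finset.univ.filter fun σ => ∀ a, blk (σ a) = blk a

/-- Number of (non-empty) blocks of the labelling `blk`; the EXCESS of the block system is `n - numBlocks blk`. -/
def numBlocks (blk : Fin n → Fin n) : ℕ := (Finset.univ.image blk).card

/-- An **admissible Garnir system** for `p` at level `k`: excess `≥ k + 1` and `p` strictly decreasing on every
block (so that `p` is the top of its coset `p · blockStab blk`). -/
def Admissible (k : ℕ) (blk : Fin n → Fin n) (p : Equiv.Perm (Fin n)) : Prop :=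
  numBlocks blk + k + 1 ≤ n ∧ ∀ a b : Fin n, blk a = blk b → a < b → p b < p a

/-- The **Garnir-avoidance set** of a target `t` at level `k`: the permutations `p` for which a straightening tree
along Garnir coset relations (the certifier's choice of block systems of excess `≥ k+1`, any shape) ends in shell
elements `≠ t` or in elements not Bruhat-above `t`. The dual functional of `t` vanishes on it
(`tokenFn_eq_zero_of_garnirAvoid`, from S1–S4). -/
inductive GarnirAvoid (n k : ℕ) (t : Equiv.Perm (Fin n)) : Equiv.Perm (Fin n) → Prop
  | shell {p : Equiv.Perm (Fin n)} : p ∈ schenstedSet n k → p ≠ t → GarnirAvoid n k t p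
  | incomparable {p : Equiv.Perm (Fin n)} : ¬ bruhatLE t p → GarnirAvoid n k t p
  | step {p : Equiv.Perm (Fin n)} (blk : Fin n → Fin n) : numBlocks blk + k + 1 ≤ n →
      (∀ σ ∈ blockStab blk, σ ≠ 1 → GarnirAvoid n k t (p * σ)) → GarnirAvoid n k t p

/-- A **Garnir-certified** triple at level `k`: `k ≤ n`, targets in the Schensted shell, and every non-target
quadruple product Garnir-avoids every target. (TPP is implied: another target `x⁻¹z` avoids `t` only through
`shell`, i.e. `x⁻¹z ≠ t`; a product equal to `t` has no certificate, cf. `separated_of_certified`.) -/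
def GarnirCertified (n k : ℕ) (X Y Z : Finset (Equiv.Perm (Fin n))) : Prop :=
  k ≤ n ∧ (∀ x ∈ X, ∀ z ∈ Z, x⁻¹ * z ∈ schenstedSet n k) ∧
    ∀ x₀ ∈ X, ∀ z₀ ∈ Z, ∀ x ∈ X, ∀ y ∈ Y, ∀ y' ∈ Y, ∀ z ∈ Z, ¬ (x = x₀ ∧ y = y' ∧ z = z₀) →
      GarnirAvoid n k (x₀⁻¹ * z₀) (x⁻¹ * y * y'⁻¹ * z)

/-- `D_k(n) = Σ_{μ ⊢ n, μ₁ ≥ n-k} (f^μ)²` (`= dim T_k`; the right-hand side of route item `TokenWall`, verbatim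
`Ideator2.levelDim` of card poly-slack-transfer). -/
def levelDim (n k : ℕ) : ℕ :=
  ∑ μ : Nat.Partition n, if n - k ≤ μ.parts.sup then numStandardTableaux μ ^ 2 else 0

/-! ## S1 — Garnir vanishing (the lever; size S–M) -/

/-- **S1 `GarnirVanishing`.** For a block labelling `blk` of excess `≥ k + 1` (`numBlocks blk + k + 1 ≤ n`), every
token table `c` and all `a, b`: `Σ_{σ ∈ blockStab blk} sgn(σ) · tokenFn c (a σ b) = 0` — the signed indicator of
any two-sided translate of the Young-subgroup coset is orthogonal to the `k`-token space. Proof (card §(3),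
triage-verified × 3): fix the tuple `p`; `b ∘ p` has `≤ k` values, the blocks have total excess `≥ k+1`, so some
block contains two positions `u ≠ v` outside `range (b ∘ p)`; `σ ↦ σ * swap u v` is a sign-reversing involution of
`blockStab blk` preserving `(a σ b) ∘ p`. Why it might fail: it does not (special cases are
`Disproof.sum_coset_sign_mul_tokenFn`, `Disproof.sum_sign_mul_tokenFn`, same proof). [cite: JamesLNM682 §7
(Garnir relations); EllisFriedgutPilpel2011 Thm 7; Disproof.lean `sum_coset_sign_mul_tokenFn`] -/
def GarnirVanishing : Prop :=
  ∀ (n k : ℕ) (blk : Fin n → Fin n), numBlocks blk + k + 1 ≤ n →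
    ∀ (c : (Fin k → Fin n) → (Fin k → Fin n) → ℂ) (a b : Equiv.Perm (Fin n)),
      (∑ σ ∈ blockStab blk, ((Equiv.Perm.sign σ : ℤ) : ℂ) * tokenFn c (a * σ * b)) = 0

/-- Registered stub S1 (statement = `GarnirVanishing`, spelled out in tree-only vocabulary); LANDED p79352
(`Theorems/LevelGradedCohnUmansSnLevelDesignsStubGarnirVanishing.lean`). -/
theorem stub_garnirVanishing :
    ∀ (n k : ℕ) (blk : Fin n → Fin n), (Finset.univ.image blk).card + k + 1 ≤ n →
      ∀ (c : (Fin k → Fin n) → (Fin k → Fin n) → ℂ) (a b : Equiv.Perm (Fin n)),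
        (∑ σ ∈ Finset.univ.filter (fun σ : Equiv.Perm (Fin n) => ∀ x, blk (σ x) = blk x),
          ((Equiv.Perm.sign σ : ℤ) : ℂ) * ∑ p : Fin k → Fin n, c p (⇑(a * σ * b) ∘ p)) = 0 :=
  Summit.MatrixMultiplication.MatrixMultiplication.Theorems.SnLevelDesigns.stub_garnirVanishing

/-! ## S2 — decreasing cover (Greene–Mirsky; size M) -/

/-- **S2 `DecreasingCover`.** A permutation outside the Schensted shell (no increasing subsequence of length
`n - k`) is strictly decreasing on the blocks of some labelling with at most `n - k - 1` blocks, i.e. it carries an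
`Admissible` Garnir system. Proof: patience levels `blk a :=` (length of the longest increasing subsequence ending
at position `a`) `- 1`; equal levels form a decreasing subsequence, and the number of levels is `lis < n - k`
(Mirsky's dual of Dilworth for the 2-dimensional order `a < b ∧ p a < p b`). Vacuous for `k ≥ n`. Why it might
fail: it does not (textbook); the cost is the finitary bookkeeping of `lis` in Lean (no Mathlib API for longest
increasing subsequences). [cite: Schensted1961 (doi:10.4153/CJM-1961-015-3); Greene1974; BjornerBrenti2005 §2] -/
def DecreasingCover : Prop :=
  ∀ (n k : ℕ) (p : Equiv.Perm (Fin n)), p ∉ schenstedSet n k → ∃ blk : Fin n → Fin n, Admissible k blk p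

/-- Registered stub S2 (statement = `DecreasingCover`, spelled out in tree-only vocabulary); LANDED p79809
(`Theorems/LevelGradedCohnUmansSnLevelDesignsStubDecreasingCover.lean`). -/
theorem stub_decreasingCover :
    ∀ (n k : ℕ) (p : Equiv.Perm (Fin n)),
      (¬ ∃ s : Finset (Fin n), n - k ≤ s.card ∧ StrictMonoOn (⇑p) (s : Set (Fin n))) →
        ∃ blk : Fin n → Fin n, (Finset.univ.image blk).card + k + 1 ≤ n ∧
          ∀ a b : Fin n, blk a = blk b → a < b → p b < p a :=
  Summit.MatrixMultiplication.MatrixMultiplication.Theorems.SnLevelDesigns.stub_decreasingCover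

/-! ## S3 — block descent (size M) -/

/-- **S3 `BlockDescent`.** If `p` is strictly decreasing on the blocks of `blk`, then every proper rearrangement
`p * σ` (`σ ∈ blockStab blk`, `σ ≠ 1`: the values of `p` permuted WITHIN blocks of positions) is Bruhat-below `p`
in the rank-matrix order and has strictly LARGER position weight `Φ` (lead reshape: `Φ` instead of the inversion
count — `p` is the `Φ`-minimum of its block coset by the rearrangement inequality / one-swap computation). Proof: for a prefix `[0,i)` and a threshold `j`, block
by block, `p` puts the LARGEST values of the block on its earliest positions, which minimises the number of values
`< j` among the first `r` positions of the block — summing over blocks gives `bruhatLE (p*σ) p`; inversions inside a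
block drop strictly where `σ` acts non-trivially and the inversions between a block and any outside position are
maximised by the decreasing arrangement (`2x + m - r - s ≤ m - |r - s|`). Why it might fail: it does not (it is
"`p` is the longest element of `p·W_J`" for a conjugated Young subgroup, checked directly on rank matrices); cost
M (finset counting). [cite: BjornerBrenti2005 Thm 2.1.5, Prop 2.4.4; Mathlib `Monovary.sum_smul_comp_perm_le_sum_smul`] -/
def BlockDescent : Prop :=
  ∀ (n : ℕ) (blk : Fin n → Fin n) (p : Equiv.Perm (Fin n)),
    (∀ a b : Fin n, blk a = blk b → a < b → p b < p a) →
    ∀ σ ∈ blockStab blk, σ ≠ 1 → bruhatLE (p * σ) p ∧ posWeight p < posWeight (p * σ)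

/-- Registered stub S3 (statement = `BlockDescent`, spelled out in tree-only vocabulary); LANDED p80268
(`Theorems/LevelGradedCohnUmansSnLevelDesignsStubBlockDescent.lean`). -/
theorem stub_blockDescent :
    ∀ (n : ℕ) (blk : Fin n → Fin n) (p : Equiv.Perm (Fin n)),
      (∀ a b : Fin n, blk a = blk b → a < b → p b < p a) →
        ∀ σ ∈ Finset.univ.filter (fun σ : Equiv.Perm (Fin n) => ∀ x, blk (σ x) = blk x), σ ≠ 1 →
          (∀ i j : ℕ,
              (Finset.univ.filter (fun a : Fin n => (a : ℕ) < i ∧ ((p a : Fin n) : ℕ) < j)).card ≤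
                (Finset.univ.filter (fun a : Fin n => (a : ℕ) < i ∧ (((p * σ) a : Fin n) : ℕ) < j)).card) ∧
            (∑ i : Fin n, (i : ℕ) * ((p i : Fin n) : ℕ)) < ∑ i : Fin n, (i : ℕ) * (((p * σ) i : Fin n) : ℕ) :=
  Summit.MatrixMultiplication.MatrixMultiplication.Theorems.SnLevelDesigns.stub_blockDescent

/-! ## S4 — shell interpolation (RSS 2009 Thm 2 at `(n-k,1^k)`; size L) -/

/-- **S4 `ShellInterpolation`** (`= Ideator3.SchenstedInterpolates` in token-table form). For `k ≤ n` every
function on the Schensted shell is the restriction of a `k`-token function; equivalently the shell is linearly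
independent in `A_k = ℂ𝔖ₙ/T_k^⊥`, equivalently NO non-zero element of the annihilator `T_k^⊥` is supported
inside the shell. With the spanning half (Garnir straightening, S1–S3, proved below) it is the COUNT
`#B_k(n) = Σ_{μ₁ ≥ n-k}(f^μ)² = dim T_k` (Schensted's theorem via RSK + `EllisFriedgutPilpel2011_thm7_holds` and
Specht dimensions `finrank_spechtIdeal_holds`) — size L because RSK is not in Mathlib; alternatively vendor
RSS 2009 Thm 2 (`arXiv:0902.2842`, p. 3, read by triage r1-2/r1-3) as a Literature fact. Guard `k ≤ n` needed
(triage r1-3 `N0self.lean`: false at `n = 0 < k`). Numerically certain: exact rank checks at all `(n,k)` with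
`n ≤ 7` and `(8,2)` by three independent codes (kit j008490, j010256, j010266/j010362). Why it might fail: it does
not over `ℂ` (published theorem); the risk is size. [cite: RaghavanSamuelSubrahmanyam2009 Thm 2 (arXiv:0902.2842);
Schensted1961; EllisFriedgutPilpel2011 Thm 7] -/
def ShellInterpolation : Prop :=
  ∀ (n k : ℕ), k ≤ n → ∀ v : Equiv.Perm (Fin n) → ℂ,
    ∃ c : (Fin k → Fin n) → (Fin k → Fin n) → ℂ, ∀ g ∈ schenstedSet n k, tokenFn c g = v g

/-- Registered stub S4 (statement = `ShellInterpolation`, spelled out in tree-only vocabulary); LANDED p78590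
(`Theorems/LevelGradedCohnUmansSnLevelDesignsStubShellInterpolation.lean`). -/
theorem stub_shellInterpolation :
    ∀ (n k : ℕ), k ≤ n → ∀ v : Equiv.Perm (Fin n) → ℂ,
      ∃ c : (Fin k → Fin n) → (Fin k → Fin n) → ℂ,
        ∀ g : Equiv.Perm (Fin n),
          (∃ s : Finset (Fin n), n - k ≤ s.card ∧ StrictMonoOn (⇑g) (s : Set (Fin n))) →
            (∑ p : Fin k → Fin n, c p (⇑g ∘ p)) = v g :=
  Summit.MatrixMultiplication.MatrixMultiplication.Theorems.SnLevelDesigns.stub_shellInterpolation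

/-! ## S5 — ε-glue: polynomial slack is free (Vershik–Kerov; size M) -/

/-- **S5 `EpsilonGlue`** (merged cards poly-slack-transfer ≈ classical-sandwich-gamma-scale, as SUPPORT glue,
uniform in the certificate `P`). If a family of level-`k` triples with property `P` satisfies
`D_k(n)^{3/2} ≤ k^C · |X||Y||Z|` with `n ≥ k³` for arbitrarily large `k`, then for every `ε > 0` some member
satisfies the crux's budget inequality `Σ_{μ₁ ≥ n-k} (f^μ)^{2+ε} < (|X||Y||Z|)^{(2+ε)/3}`. Proof (triage r1-1/2/3
re-derived (i)–(v)): `Σ f^{2+ε} ≤ F^ε D_k` with `F = max_{μ₁ ≥ n-k} f^μ ≤ C(n,k)·maxCharDegree(𝔖_k)·(1+o(1))`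
(hook-length peeling `f_{(n-j,ν)} ≤ C(n,j) f_ν`), `D_k ≥ C(n,k)² k! e^{-3/k}` for `n ≥ k³`, and the Vershik–Kerov
upper bound `maxCharDegree(𝔖_k) ≤ √(k!) e^{-(c₂/2)√k}` (`VershikKerov1985_maxCharDegree_holds`, PROVED in tree)
give `(F/√D_k)^ε ≤ e^{-(c₂/2)ε√k + O(1/k)} < k^{-C(2+ε)/3}` for `k ≥ k₁(ε, C)`; note `D_k ≥ 1` forces `V ≥ 1`.
Why it might fail: it does not (pure asymptotics, all inputs in tree); cost = `Real.rpow` bookkeeping.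
[cite: VershikKerov1985 (via PakPanovaYeliussizov2019 arXiv:1804.04693 §2.3); BlasiakChurchCohnGrochowUmans2017 §4;
`numStandardTableaux_mul_prod_hookLength_holds`] -/
def EpsilonGlue : Prop :=
  ∀ P : (n : ℕ) → ℕ → Finset (Equiv.Perm (Fin n)) → Finset (Equiv.Perm (Fin n)) →
      Finset (Equiv.Perm (Fin n)) → Prop,
    (∃ C : ℕ, ∀ k₀ : ℕ, ∃ k : ℕ, k₀ ≤ k ∧ ∃ (n : ℕ) (X Y Z : Finset (Equiv.Perm (Fin n))),
        k ^ 3 ≤ n ∧ P n k X Y Z ∧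
          ((levelDim n k : ℕ) : ℝ) ^ ((3 : ℝ) / 2) ≤ (k : ℝ) ^ C * ((X.card * Y.card * Z.card : ℕ) : ℝ)) →
    ∀ ε : ℝ, 0 < ε → ∃ (n k : ℕ) (X Y Z : Finset (Equiv.Perm (Fin n))), P n k X Y Z ∧
      (∑ μ : Nat.Partition n,
          if n - k ≤ μ.parts.sup then (numStandardTableaux μ : ℝ) ^ (2 + ε) else 0) <
        ((X.card * Y.card * Z.card : ℕ) : ℝ) ^ ((2 + ε) / 3)

/-- **S5h `FirstRowHooks`** (LEAD RESHAPE of S5, first half; size L, provable now from the tree's hook length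
formula `numStandardTableaux_mul_prod_hookLength_holds`): FIRST-ROW PEELING for the shapes the budget sums over.
Write a shape `μ ⊢ n` with largest part `m = μ.parts.sup` as `μ = (m, ν)`, `ν ⊢ j := n - m`; the hooks of `μ` in
rows `≥ 1` are the hooks of `ν`, and the hook of the box `(0, c)` is `(m - c) + ν'_c ≥ m - c`. Hence
(a) `f^μ = n!/∏h ≤ n!/(m! · j!/f^ν) = C(n,j) f^ν ≤ C(n,j) · D(j)` (`D(j) = maxCharDegree 𝔖_j`,
`numStandardTableaux_le_maxCharDegree`); and (b) for `3k ≤ n` and every `ν ⊢ k` the shape `(n-k, ν)` has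
`∏_{c} h(0,c) = (n-k)! ∏_{c<ν₁}(1 + ν'_c/(n-k-c)) ≤ (n-k)! e^{k/(n-2k+1)} ≤ e·(n-k)!`, so
`f^{(n-k,ν)} ≥ C(n,k) f^ν / e`, and summing the squares over `ν ⊢ k` (`Σ (f^ν)² = k!`,
`sum_sq_numStandardTableaux`; the shapes `(n-k,ν)` are pairwise distinct level-`k` shapes)
`levelDim n k ≥ e^{-2} C(n,k)² k!`. [cite: FrameRobinsonThrallCJM1954 Thm 1; FultonYoungTableaux1997 §7.2] -/
def FirstRowHooks : Prop :=
  (∀ (n : ℕ) (μ : Nat.Partition n),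
      numStandardTableaux μ ≤ n.choose (n - μ.parts.sup) *
        Literature.RepresentationTheory.FiniteGroups.maxCharDegree (Equiv.Perm (Fin (n - μ.parts.sup)))) ∧
  (∀ (n k : ℕ), 3 * k ≤ n →
      Real.exp (-2) * ((n.choose k : ℝ) ^ 2 * (k.factorial : ℝ)) ≤ ((levelDim n k : ℕ) : ℝ))

/-- Registered stub S5h (statement = `FirstRowHooks`, spelled out in tree-only vocabulary); LANDED p83778
(`Theorems/LevelGradedCohnUmansSnLevelDesignsStubFirstRowHooks.lean`). -/
theorem stub_firstRowHooks :
    (∀ (n : ℕ) (μ : Nat.Partition n),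
        Literature.NumberTheory.DiophantineGeometry.numStandardTableaux μ ≤ n.choose (n - μ.parts.sup) *
          Literature.RepresentationTheory.FiniteGroups.maxCharDegree (Equiv.Perm (Fin (n - μ.parts.sup)))) ∧
      (∀ (n k : ℕ), 3 * k ≤ n →
        Real.exp (-2) * ((n.choose k : ℝ) ^ 2 * (k.factorial : ℝ)) ≤
          ((∑ μ : Nat.Partition n, if n - k ≤ μ.parts.sup then
              Literature.NumberTheory.DiophantineGeometry.numStandardTableaux μ ^ 2 else 0 : ℕ) : ℝ)) :=
  Summit.MatrixMultiplication.MatrixMultiplication.Theorems.SnLevelDesigns.stub_firstRowHooks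

/-- **S5g `HookGlue`** (LEAD RESHAPE of S5, second half; size M, real analysis only): `FirstRowHooks → EpsilonGlue`.
Given the family hypothesis of `EpsilonGlue` (`D_k^{3/2} ≤ k^C V`, `n ≥ k³`, `k` arbitrarily large) and `ε > 0`:
`budget = Σ_{μ₁≥n-k}(f^μ)^{2+ε} ≤ F^ε · D_k` with `F = max_{μ₁ ≥ n-k} f^μ`; by (a), for `j := n - μ₁ ≤ k`,
`f^μ ≤ C(n,j) D(j)`, and by (b) `√D_k ≥ e^{-1} C(n,k) √(k!)`; since `n ≥ k³`, `C(n,j)/C(n,k) ≤ (k/(n-k))^{k-j}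
≤ k^{-(k-j)}`; for `j ≤ k/2` this is `≤ k^{-k/2}`, for `j > k/2` use `D(j) ≤ √(j!) e^{-(c₂/2)√j}` (tree theorem
`VershikKerov1985_maxCharDegree_holds` at `ε := vkUpperConst/2`, `j ≥ n₀`) — so `θ := F/√D_k ≤ e^{1-c'√k}`,
`c' = vkUpperConst/(2√2)`, for `k ≥ k₁`; finally choose `k₀ ≥ k₁` with `θ^ε · k^{C(2+ε)/3} < 1`: then
`budget ≤ θ^ε D_k^{1+ε/2} < k^{-C(2+ε)/3} D_k^{1+ε/2} ≤ V^{(2+ε)/3}` (`D_k ≥ 1`). -/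
def HookGlue : Prop :=
  FirstRowHooks → EpsilonGlue

/-- Registered stub S5g (statement = `HookGlue`, spelled out in tree-only vocabulary); LANDED p77815
(`Theorems/LevelGradedCohnUmansSnLevelDesignsStubHookGlue.lean`). -/
theorem stub_hookGlue :
    ((∀ (n : ℕ) (μ : Nat.Partition n),
        Literature.NumberTheory.DiophantineGeometry.numStandardTableaux μ ≤ n.choose (n - μ.parts.sup) *
          Literature.RepresentationTheory.FiniteGroups.maxCharDegree (Equiv.Perm (Fin (n - μ.parts.sup)))) ∧
      (∀ (n k : ℕ), 3 * k ≤ n →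
        Real.exp (-2) * ((n.choose k : ℝ) ^ 2 * (k.factorial : ℝ)) ≤
          ((∑ μ : Nat.Partition n, if n - k ≤ μ.parts.sup then
              Literature.NumberTheory.DiophantineGeometry.numStandardTableaux μ ^ 2 else 0 : ℕ) : ℝ))) →
      ∀ P : (n : ℕ) → ℕ → Finset (Equiv.Perm (Fin n)) → Finset (Equiv.Perm (Fin n)) →
          Finset (Equiv.Perm (Fin n)) → Prop,
        (∃ C : ℕ, ∀ k₀ : ℕ, ∃ k : ℕ, k₀ ≤ k ∧ ∃ (n : ℕ) (X Y Z : Finset (Equiv.Perm (Fin n))),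
            k ^ 3 ≤ n ∧ P n k X Y Z ∧
              ((∑ μ : Nat.Partition n, if n - k ≤ μ.parts.sup then
                  Literature.NumberTheory.DiophantineGeometry.numStandardTableaux μ ^ 2 else 0 : ℕ) : ℝ) ^ ((3 : ℝ) / 2) ≤
                (k : ℝ) ^ C * ((X.card * Y.card * Z.card : ℕ) : ℝ)) →
        ∀ ε : ℝ, 0 < ε → ∃ (n k : ℕ) (X Y Z : Finset (Equiv.Perm (Fin n))), P n k X Y Z ∧
          (∑ μ : Nat.Partition n, if n - k ≤ μ.parts.sup then
              (Literature.NumberTheory.DiophantineGeometry.numStandardTableaux μ : ℝ) ^ (2 + ε) else 0) <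
            ((X.card * Y.card * Z.card : ℕ) : ℝ) ^ ((2 + ε) / 3) :=
  Summit.MatrixMultiplication.MatrixMultiplication.Theorems.SnLevelDesigns.stub_hookGlue

/-! ## S5' — the NearWall (sub-exponential slack) glue — LEAD RESHAPE 2 (adopting the planner gen-2 variant) -/

/-- The **sub-exponential wall form** of a family of level-`k` triples with property `P` (planner gen-2 variant
`GarnirAnnihilatorNearWallVariant.lean`, adopted): for every `δ > 0` and every `k₀` there is a member with `k ≥ k₀`,
`3k ≤ n`, property `P`, and `D_k(n)^{3/2} ≤ e^{δ√k} · |X||Y||Z|`. By the power-mean inequality this is what the crux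
forces of its own witnesses as `ε → 0` (`e^{-O(ε√k)}` slack), whereas the polynomial form `k^{-C}` of `EpsilonGlue`'s
hypothesis is NOT forced — so this is the right wall clause for the construction stub. -/
def NearWall (P : (n : ℕ) → ℕ → Finset (Equiv.Perm (Fin n)) → Finset (Equiv.Perm (Fin n)) →
    Finset (Equiv.Perm (Fin n)) → Prop) : Prop :=
  ∀ δ : ℝ, 0 < δ → ∀ k₀ : ℕ, ∃ k : ℕ, k₀ ≤ k ∧ ∃ (n : ℕ) (X Y Z : Finset (Equiv.Perm (Fin n))),
    3 * k ≤ n ∧ P n k X Y Z ∧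
      ((levelDim n k : ℕ) : ℝ) ^ ((3 : ℝ) / 2) ≤
        Real.exp (δ * Real.sqrt (k : ℝ)) * ((X.card * Y.card * Z.card : ℕ) : ℝ)

/-- **S5g' `NearWallGlue`** (planner gen-2's `HookGlue`, adopted as a new registered stub; size M, provable now):
`FirstRowHooks →` for ANY property `P`, `NearWall P →` every `ε > 0` has a member with the crux's budget inequality.
Proof: `Σ f^{2+ε} ≤ θ^ε D_k^{1+ε/2}` with `θ := F/√D_k ≤ e^{1-c'√k}` for `3k ≤ n`, `k ≥ k₁` (S5h (a),(b): for
`j := n - μ₁ ≤ k`, `f^μ ≤ C(n,j)D(j)`, `√D_k ≥ e^{-1}C(n,k)√(k!)`, `C(n,j)/C(n,k) ≤ (k/(n-k+1))^{k-j} ≤ 2^{-(k-j)}`,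
`D(j) ≤ √(j!)` always and `≤ √(j!)e^{-(c₂/2)√j}` for `j ≥ n₀` by `VershikKerov1985_maxCharDegree_holds`); given `ε`
take `δ := c'ε/(4(2+ε))`-ish in `NearWall` and `k₀` large. -/
def NearWallGlue : Prop :=
  FirstRowHooks →
    ∀ P : (n : ℕ) → ℕ → Finset (Equiv.Perm (Fin n)) → Finset (Equiv.Perm (Fin n)) →
        Finset (Equiv.Perm (Fin n)) → Prop,
      NearWall P →
        ∀ ε : ℝ, 0 < ε → ∃ (n k : ℕ) (X Y Z : Finset (Equiv.Perm (Fin n))), P n k X Y Z ∧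
          (∑ μ : Nat.Partition n,
              if n - k ≤ μ.parts.sup then (numStandardTableaux μ : ℝ) ^ (2 + ε) else 0) <
            ((X.card * Y.card * Z.card : ℕ) : ℝ) ^ ((2 + ε) / 3)

/-- Registered stub S5g' (statement = `NearWallGlue`, spelled out in tree-only vocabulary; identical text to the
planner gen-2 variant's `stub_hookGlue`). -/
theorem stub_nearWallGlue :
    ((∀ (n : ℕ) (μ : Nat.Partition n),
        Literature.NumberTheory.DiophantineGeometry.numStandardTableaux μ ≤ n.choose (n - μ.parts.sup) *
          Literature.RepresentationTheory.FiniteGroups.maxCharDegree (Equiv.Perm (Fin (n - μ.parts.sup)))) ∧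
      (∀ (n k : ℕ), 3 * k ≤ n →
        Real.exp (-2) * ((n.choose k : ℝ) ^ 2 * (k.factorial : ℝ)) ≤
          ((∑ μ : Nat.Partition n, if n - k ≤ μ.parts.sup then
              Literature.NumberTheory.DiophantineGeometry.numStandardTableaux μ ^ 2 else 0 : ℕ) : ℝ))) →
      ∀ P : (n : ℕ) → ℕ → Finset (Equiv.Perm (Fin n)) → Finset (Equiv.Perm (Fin n)) →
          Finset (Equiv.Perm (Fin n)) → Prop,
        (∀ δ : ℝ, 0 < δ → ∀ k₀ : ℕ, ∃ k : ℕ, k₀ ≤ k ∧ ∃ (n : ℕ) (X Y Z : Finset (Equiv.Perm (Fin n))),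
            3 * k ≤ n ∧ P n k X Y Z ∧
              ((∑ μ : Nat.Partition n, if n - k ≤ μ.parts.sup then
                  Literature.NumberTheory.DiophantineGeometry.numStandardTableaux μ ^ 2 else 0 : ℕ) : ℝ) ^ ((3 : ℝ) / 2) ≤
                Real.exp (δ * Real.sqrt (k : ℝ)) * ((X.card * Y.card * Z.card : ℕ) : ℝ)) →
        ∀ ε : ℝ, 0 < ε → ∃ (n k : ℕ) (X Y Z : Finset (Equiv.Perm (Fin n))), P n k X Y Z ∧
          (∑ μ : Nat.Partition n, if n - k ≤ μ.parts.sup then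
              (Literature.NumberTheory.DiophantineGeometry.numStandardTableaux μ : ℝ) ^ (2 + ε) else 0) <
            ((X.card * Y.card * Z.card : ℕ) : ℝ) ^ ((2 + ε) / 3) :=
  Summit.MatrixMultiplication.MatrixMultiplication.Theorems.SnLevelDesigns.stub_nearWallGlue

/-! ## S6' — FLOATING-frame Garnir-certified designs, sub-exponentially near the wall (the closer; open) — LEAD RESHAPE 2

WHY THE RESHAPE (answer to `NegativeNotes-garnir-annihilator-drefute-g3.md`). The gen-1 certificate `GarnirCertified`
reads every target `t = x₀⁻¹z₀` against ONE fixed interpolation set, the Schensted shell `B_k`, and therefore forces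
`X⁻¹Z ⊆ B_k` injectively with `|X|,|Z| ≥ √D_k·(slack)` — the Y-free packing problem "SF" in the Ulam ball, which the
refuter's Collision Ladder (★) (landed `Negative/CollisionLadder.lean`) and Theorem Q make exponentially lossy
(`|X||Z| ≤ 0.83^k D_k` on every coarse-split family; residual Conjecture F). That obstruction is an artefact of fixing
the shell: the `k`-token space is TWO-SIDED translation invariant (`tokenFn_translate` below), so EVERY translate
`a⁻¹·B_k·b⁻¹` is an interpolation set (S4 translated), and the dual functional of `a·t·b ∈ B_k` read in the frame
`g ↦ a·g·b` is a separator for `t` as soon as the relative garbage `a·p·b` Garnir-avoids `a·t·b`. Choosing the frame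
PER TARGET (`FloatingCertified`) removes the clause "all targets in one ball" entirely — targets are arbitrary, as in
the crux — while keeping the same kernel-checked certificate calculus (S1–S4) and the same composition. -/

/-- **FLOATING Garnir certificate** (LEAD RESHAPE 2): `k ≤ n` and, for every target `t = x₀⁻¹z₀`, a FRAME
`(a, b) ∈ 𝔖ₙ²` with `a·t·b` in the Schensted shell such that every non-target quadruple product `p`, read in the same
frame, Garnir-avoids it: `GarnirAvoid n k (a t b) (a p b)`. The gen-1 `GarnirCertified` is the case `a = b = 1`
(`floatingCertified_of_garnirCertified`); TPP is still implied (a non-target `p = t` would need `GarnirAvoid s s`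
to kill `f_s(s) = 1`). -/
def FloatingCertified (n k : ℕ) (X Y Z : Finset (Equiv.Perm (Fin n))) : Prop :=
  k ≤ n ∧ ∀ x₀ ∈ X, ∀ z₀ ∈ Z, ∃ a b : Equiv.Perm (Fin n), a * (x₀⁻¹ * z₀) * b ∈ schenstedSet n k ∧
    ∀ x ∈ X, ∀ y ∈ Y, ∀ y' ∈ Y, ∀ z ∈ Z, ¬ (x = x₀ ∧ y = y' ∧ z = z₀) →
      GarnirAvoid n k (a * (x₀⁻¹ * z₀) * b) (a * (x⁻¹ * y * y'⁻¹ * z) * b)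

/-- The gen-1 construction target (kept for the record; polynomial slack, `n ≥ k³`, fixed shell): `GarnirDesigns`.
It implies `FloatingDesigns` (`floatingDesigns_of_garnirDesigns`), so nothing proved about it is lost. -/
def GarnirDesigns : Prop :=
  ∃ C : ℕ, ∀ k₀ : ℕ, ∃ k : ℕ, k₀ ≤ k ∧ ∃ (n : ℕ) (X Y Z : Finset (Equiv.Perm (Fin n))),
    k ^ 3 ≤ n ∧ GarnirCertified n k X Y Z ∧
      ((levelDim n k : ℕ) : ℝ) ^ ((3 : ℝ) / 2) ≤ (k : ℝ) ^ C * ((X.card * Y.card * Z.card : ℕ) : ℝ)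

/-- **S6' `FloatingDesigns`** (LEAD RESHAPE 2; the line's construction target `C⁺`, open): `NearWall FloatingCertified`
— for every `δ > 0` and arbitrarily large `k` some `n ≥ 3k` carries a FLOATING-frame Garnir-certified triple with
`D_k(n)^{3/2} ≤ e^{δ√k}·|X||Y||Z|`. Strictly weaker than the registered gen-1 `GarnirDesigns` (fixed frame, `k^C`,
`n ≥ k³`) and not subject to the shell-packing obstruction SF; still the crux's construction problem (with
`GradedPricing` it gives `ω = 2`), honestly named. What a witness must still satisfy: the Y-walls and the graded
Neumann count (`|X||Y|,|Y||Z|,|X||Z| ≤ D_k`, `V ≤ 0.385 D_k^{3/2}` — consistent with `e^{-δ√k}` slack), TPP, and per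
target the avoidance of ONE shell element by the framed garbage set `a_t·(Q∖t)·b_t`. -/
def FloatingDesigns : Prop :=
  NearWall FloatingCertified

/-- Registered stub S6' (statement = `FloatingDesigns`, `NearWall` unfolded; the lead's stub). -/
theorem stub_floatingGarnirDesigns :
    ∀ δ : ℝ, 0 < δ → ∀ k₀ : ℕ, ∃ k : ℕ, k₀ ≤ k ∧ ∃ (n : ℕ) (X Y Z : Finset (Equiv.Perm (Fin n))),
      3 * k ≤ n ∧ FloatingCertified n k X Y Z ∧
        ((levelDim n k : ℕ) : ℝ) ^ ((3 : ℝ) / 2) ≤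
          Real.exp (δ * Real.sqrt (k : ℝ)) * ((X.card * Y.card * Z.card : ℕ) : ℝ) := by
  sorry

/-! ## J — the JUNTA sub-certificate (LEAD c1 RESHAPE 3)

A triple is **junta separated** at level `k` if every target `t = x₀⁻¹z₀` is told apart from each of its garbage products
`g = x⁻¹yy'⁻¹z` by the restriction to ONE frame `ι : Fin k → Fin n` chosen per target: `g ∘ ι ≠ t ∘ ι`. The separator is
then the single coset indicator `g ↦ [g ∘ ι = t ∘ ι]`, a `k`-token function with table `c p q = [p = ι ∧ q = t ∘ ι]`
(`separated_of_juntaSeparated`). In forbidden-frame form (used by the constructions/obstructions in NOTES): at target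
`(x₀,z₀)` with `W = z₀(range ι)`, the frame sets `{(z z₀⁻¹)|_W : z ∈ Z}` and `{(yy'⁻¹)⁻¹(x₀x⁻¹)⁻¹|_W}` meet only in the
identity frame, which each side represents exactly once. -/

/-- **Junta separation** (frame form, matching the crux's tests; `ι` need not be injective — a frame with `j < k`
distinct points is a `j`-junta). -/
def JuntaSeparated (n k : ℕ) (X Y Z : Finset (Equiv.Perm (Fin n))) : Prop :=
  ∀ x₀ ∈ X, ∀ z₀ ∈ Z, ∃ ι : Fin k → Fin n, ∀ x ∈ X, ∀ y ∈ Y, ∀ y' ∈ Y, ∀ z ∈ Z,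
    ¬ (x = x₀ ∧ y = y' ∧ z = z₀) → (⇑(x⁻¹ * y * y'⁻¹ * z)) ∘ ι ≠ (⇑(x₀⁻¹ * z₀)) ∘ ι

/-- **Junta ⇒ separated** (directly): the coset indicator `[g ∘ ι = t ∘ ι]` is the `k`-token function with table
`c p q = [p = ι] [q = t ∘ ι]`; it is `1` at the target quadruples (`x₀⁻¹ y y⁻¹ z₀ = x₀⁻¹ z₀`) and `0` on the garbage. -/
theorem separated_of_juntaSeparated {n k : ℕ} {X Y Z : Finset (Equiv.Perm (Fin n))}
    (h : JuntaSeparated n k X Y Z) : KTokenSeparated n k X Y Z := by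
  classical
  intro x₀ hx₀ z₀ hz₀
  obtain ⟨ι, hι⟩ := h x₀ hx₀ z₀ hz₀
  refine ⟨fun p q => if p = ι ∧ q = (⇑(x₀⁻¹ * z₀)) ∘ ι then 1 else 0, fun x hx y hy y' hy' z hz => ?_⟩
  rw [Finset.sum_eq_single ι]
  · dsimp only
    by_cases htarget : x = x₀ ∧ y = y' ∧ z = z₀
    · obtain ⟨rfl, rfl, rfl⟩ := htarget
      simp
    · rw [if_neg htarget, if_neg (fun h => hι x hx y hy y' hy' z hz htarget h.2)]
  · intro p _ hp
    dsimp only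
    rw [if_neg (fun h => hp h.1)]
  · intro h
    exact absurd (Finset.mem_univ ι) h

/-- The **Bruhat-top shell element** at level `j ≤ n`: `sTop n j hj = [j, j+1, …, n-1 | j-1, j-2, …, 0]` — the head is the
increasing run of length `n - j` (so `lis = n - j`, `sTop ∈ B_j ⊆ B_k` for `j ≤ k`), the tail is the DECREASING arrangement of
the `j` smallest values (the Bruhat-top of its coset), which makes the upper Bruhat cone of `sTop` a single `j`-coset
(`stub_topCone`). As a function: `a ↦ a + j` for `a < n - j`, `a ↦ n - 1 - a` for `a ≥ n - j`. -/
def sTop (n j : ℕ) (hj : j ≤ n) : Equiv.Perm (Fin n) where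
  toFun a := ⟨if (a : ℕ) < n - j then (a : ℕ) + j else n - 1 - (a : ℕ), by
    have := a.isLt; split_ifs <;> omega⟩
  invFun b := ⟨if (b : ℕ) < j then n - 1 - (b : ℕ) else (b : ℕ) - j, by
    have := b.isLt; split_ifs <;> omega⟩
  left_inv a := by
    have := a.isLt
    apply Fin.ext
    dsimp only
    split_ifs <;> omega
  right_inv b := by
    have := b.isLt
    apply Fin.ext
    dsimp only
    split_ifs <;> omega

theorem sTop_apply_val (n j : ℕ) (hj : j ≤ n) (a : Fin n) :
    ((sTop n j hj a : Fin n) : ℕ) = if (a : ℕ) < n - j then (a : ℕ) + j else n - 1 - (a : ℕ) := rfl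

/-- `sTop n j ∈ B_k` for `j ≤ k`: the head `{a : a < n - j}` is an increasing set of size `n - j ≥ n - k`. -/
theorem sTop_mem_schenstedSet {n j k : ℕ} (hj : j ≤ n) (hjk : j ≤ k) : sTop n j hj ∈ schenstedSet n k := by
  classical
  refine ⟨Finset.univ.filter (fun a : Fin n => (a : ℕ) < n - j), ?_, ?_⟩
  · have hcard : (Finset.univ.filter (fun a : Fin n => (a : ℕ) < n - j)).card = n - j := by
      have := Fin.card_filter_val_lt (n := n) (m := n - j)
      simpa [Nat.min_eq_left (Nat.sub_le n j)] using this
    omega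
  · intro a ha b hb hab
    simp only [Finset.coe_filter, Finset.mem_univ, true_and, Set.mem_setOf_eq] at ha hb
    show sTop n j hj a < sTop n j hj b
    rw [Fin.lt_def, sTop_apply_val, sTop_apply_val, if_pos ha, if_pos hb]
    exact Nat.add_lt_add_right (Fin.lt_def.mp hab) j

/-- **J1 `TopCone`** (registered stub, size M, provable now; pure rank-matrix counting): if `q` is Bruhat-ABOVE the
Bruhat-top shell element `sTop n j` in the rank-matrix order of this file (`bruhatLE (sTop n j) q`: for all `I, J`,
`#{a < I : q a < J} ≤ #{a < I : sTop a < J}`), then `q` agrees with `sTop` on the whole tail: `q a = n - 1 - a` for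
`a ≥ n - j`. Proof: `I = n - j, J = j` gives no value `< j` in the head of `q`, so the tail of `q` carries exactly the values
`< j`; then `I = n - j + r, J = j - r` (`r < j`) gives that none of the first `r` tail values is `< j - r`, i.e. they are
`{j-r, …, j-1}`, whence the `r`-th tail value is `j - 1 - r`. (Stated with `sTop` unfolded to its value formula, tree
vocabulary only.) [cite: BjornerBrenti2005 Thm 2.1.5 (rank-matrix criterion)] -/
def TopCone : Prop :=
  ∀ (n j : ℕ), j ≤ n → ∀ q : Equiv.Perm (Fin n),
    (∀ I J : ℕ,
      (Finset.univ.filter (fun a : Fin n => (a : ℕ) < I ∧ ((q a : Fin n) : ℕ) < J)).card ≤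
        (Finset.univ.filter (fun a : Fin n =>
          (a : ℕ) < I ∧ (if (a : ℕ) < n - j then (a : ℕ) + j else n - 1 - (a : ℕ)) < J)).card) →
    ∀ a : Fin n, n - j ≤ (a : ℕ) → ((q a : Fin n) : ℕ) = n - 1 - (a : ℕ)

/-- Registered stub J1 (statement = `TopCone`, tree-only vocabulary); LANDED p97827
(`Theorems/LevelGradedCohnUmansSnLevelDesignsStubTopCone.lean`, worker of lead c1). -/
theorem stub_topCone :
    ∀ (n j : ℕ), j ≤ n → ∀ q : Equiv.Perm (Fin n),
      (∀ I J : ℕ,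
        (Finset.univ.filter (fun a : Fin n => (a : ℕ) < I ∧ ((q a : Fin n) : ℕ) < J)).card ≤
          (Finset.univ.filter (fun a : Fin n =>
            (a : ℕ) < I ∧ (if (a : ℕ) < n - j then (a : ℕ) + j else n - 1 - (a : ℕ)) < J)).card) →
      ∀ a : Fin n, n - j ≤ (a : ℕ) → ((q a : Fin n) : ℕ) = n - 1 - (a : ℕ) :=
  Summit.MatrixMultiplication.MatrixMultiplication.Theorems.SnLevelDesigns.stub_topCone

/-- The cone lemma in this file's vocabulary: `bruhatLE (sTop n j) q` pins the tail of `q`. -/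
theorem tail_eq_of_bruhatLE_sTop (hT : TopCone) {n j : ℕ} (hj : j ≤ n) {q : Equiv.Perm (Fin n)}
    (h : bruhatLE (sTop n j hj) q) (a : Fin n) (ha : n - j ≤ (a : ℕ)) : ((q a : Fin n) : ℕ) = n - 1 - (a : ℕ) := by
  refine hT n j hj q (fun I J => ?_) a ha
  refine (h I J).trans (le_of_eq ?_)
  congr 1

/-- **J2 `UniformJuntaWall`** (registered stub, size S, provable now): if ONE frame `ι` tells every target apart from its
`y = y'` garbage (the sub-case `(x, z) ≠ (x₀, z₀)` of junta separation with a target-INDEPENDENT frame), then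
`(x, z) ↦ (x⁻¹ z) ∘ ι` is injective on `X × Z`, so `|X|·|Z| ≤ n^k` — exponentially below the wall `D_k ≈ n^{2k}/k!` that a
near-wall family needs. So in any junta design the frame must FLOAT with the target. -/
def UniformJuntaWall : Prop :=
  ∀ (n k : ℕ) (X Z : Finset (Equiv.Perm (Fin n))) (ι : Fin k → Fin n),
    (∀ x₀ ∈ X, ∀ z₀ ∈ Z, ∀ x ∈ X, ∀ z ∈ Z, ¬ (x = x₀ ∧ z = z₀) → (⇑(x⁻¹ * z)) ∘ ι ≠ (⇑(x₀⁻¹ * z₀)) ∘ ι) →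
    X.card * Z.card ≤ n ^ k

/-- Registered stub J2 (statement = `UniformJuntaWall`, tree-only vocabulary); LANDED p98831
(`Theorems/LevelGradedCohnUmansSnLevelDesignsStubUniformJuntaWall.lean`, worker of lead c1). -/
theorem stub_uniformJuntaWall :
    ∀ (n k : ℕ) (X Z : Finset (Equiv.Perm (Fin n))) (ι : Fin k → Fin n),
      (∀ x₀ ∈ X, ∀ z₀ ∈ Z, ∀ x ∈ X, ∀ z ∈ Z, ¬ (x = x₀ ∧ z = z₀) →
        (⇑(x⁻¹ * z)) ∘ ι ≠ (⇑(x₀⁻¹ * z₀)) ∘ ι) →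
      X.card * Z.card ≤ n ^ k :=
  Summit.MatrixMultiplication.MatrixMultiplication.Theorems.SnLevelDesigns.stub_uniformJuntaWall

/-- **J3 `HostedMiddleWall`** (registered stub, LEAD c1 RESHAPE 4; size M–L, provable now): the "AGL-hosted middle set"
architecture is dead for the junta certificate by a factor `√(k!)`. Abstractly: let `G ≤ 𝔖ₙ` be a subgroup such that
(H1) every set of `< k` points has a non-trivial pointwise stabiliser in `G`, and (H2) `G` is transitive on the injective
`k`-frames whose image has TRIVIAL pointwise stabiliser in `G` (for `G = AGL_d(𝔽_q) < 𝔖_{q^d}`, `k = d + 1`: the frames in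
general position, on which `AGL_d` is regular — the route's named candidate host). If the difference set `YY⁻¹` covers `G`
(H3) and `(X, Y, Z)` is junta separated (H4), then `|X|·|Z| ≤ C(n,k)²`. Proof: junta at target `(x₀,z₀)` with frame `ι`
forces `G_{(W)} = 1` for `W = z₀(im ι)` (a non-trivial `g = yy'⁻¹ ∈ G_{(W)}` makes the garbage `(x₀,y,y',z₀)` agree with the
target on `ι`), hence `ι` is injective (H1); and for two targets `(x₀,z₀), (x₁,z₀)` with the same `k`-set
`V = (x₀⁻¹z₀)(im ι₀) = (x₁⁻¹z₀)(im ι₁)`, (H2) carries the frame `z₀ ∘ ι₀` to `x₁x₀⁻¹ ∘ z₀ ∘ ι₀` by some `g = yy'⁻¹ ∈ G`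
(H3), and then the garbage `(x₁, y, y', z₀)` agrees with the target `(x₀, z₀)` on `ι₀` — so `x ↦ V` is injective into the
`k`-subsets; symmetrically `z ↦ im ι` for a fixed `x₀`. Consequence (with the token wall `|X||Y| ≤ D_k` and S5h
`D_k ≥ e^{-2}C(n,k)²k!` for `3k ≤ n`): `|X||Y||Z| ≤ C(n,k)·D_k ≤ e·D_k^{3/2}/√(k!)` — an `e^{-Θ(k log k)}` loss where
`NearWall` tolerates only `e^{-δ√k}`: no near-wall junta family has a middle set whose difference set contains such a host. -/
def HostedMiddleWall : Prop :=
  ∀ (n k : ℕ) (X Y Z : Finset (Equiv.Perm (Fin n))) (G : Subgroup (Equiv.Perm (Fin n))),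
    (∀ S : Finset (Fin n), S.card < k → ∃ g ∈ G, g ≠ 1 ∧ ∀ s ∈ S, g s = s) →
    (∀ φ ψ : Fin k → Fin n, Function.Injective φ → Function.Injective ψ →
        (∀ g ∈ G, (∀ i, g (φ i) = φ i) → g = 1) → (∀ g ∈ G, (∀ i, g (ψ i) = ψ i) → g = 1) →
        ∃ g ∈ G, ∀ i, g (φ i) = ψ i) →
    (∀ g ∈ G, ∃ y ∈ Y, ∃ y' ∈ Y, g = y * y'⁻¹) →
    (∀ x₀ ∈ X, ∀ z₀ ∈ Z, ∃ ι : Fin k → Fin n, ∀ x ∈ X, ∀ y ∈ Y, ∀ y' ∈ Y, ∀ z ∈ Z,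
        ¬ (x = x₀ ∧ y = y' ∧ z = z₀) → (⇑(x⁻¹ * y * y'⁻¹ * z)) ∘ ι ≠ (⇑(x₀⁻¹ * z₀)) ∘ ι) →
    X.card * Z.card ≤ n.choose k * n.choose k

/-- Registered stub J3 (statement = `HostedMiddleWall`, tree-only vocabulary); LANDED p106533
(`Theorems/LevelGradedCohnUmansSnLevelDesignsStubHostedMiddleWall.lean`, lead c1). -/
theorem stub_hostedMiddleWall :
    ∀ (n k : ℕ) (X Y Z : Finset (Equiv.Perm (Fin n))) (G : Subgroup (Equiv.Perm (Fin n))),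
      (∀ S : Finset (Fin n), S.card < k → ∃ g ∈ G, g ≠ 1 ∧ ∀ s ∈ S, g s = s) →
      (∀ φ ψ : Fin k → Fin n, Function.Injective φ → Function.Injective ψ →
          (∀ g ∈ G, (∀ i, g (φ i) = φ i) → g = 1) → (∀ g ∈ G, (∀ i, g (ψ i) = ψ i) → g = 1) →
          ∃ g ∈ G, ∀ i, g (φ i) = ψ i) →
      (∀ g ∈ G, ∃ y ∈ Y, ∃ y' ∈ Y, g = y * y'⁻¹) →
      (∀ x₀ ∈ X, ∀ z₀ ∈ Z, ∃ ι : Fin k → Fin n, ∀ x ∈ X, ∀ y ∈ Y, ∀ y' ∈ Y, ∀ z ∈ Z,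
          ¬ (x = x₀ ∧ y = y' ∧ z = z₀) → (⇑(x⁻¹ * y * y'⁻¹ * z)) ∘ ι ≠ (⇑(x₀⁻¹ * z₀)) ∘ ι) →
      X.card * Z.card ≤ n.choose k * n.choose k :=
  Summit.MatrixMultiplication.MatrixMultiplication.Theorems.SnLevelDesigns.stub_hostedMiddleWall

/-- J3 in this file's vocabulary: a junta design whose middle difference set covers a frame-transitive host `G` has
`|X||Z| ≤ C(n,k)²`. -/
theorem card_mul_card_le_of_hostedMiddle (hH : HostedMiddleWall) {n k : ℕ} {X Y Z : Finset (Equiv.Perm (Fin n))}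
    (G : Subgroup (Equiv.Perm (Fin n)))
    (h1 : ∀ S : Finset (Fin n), S.card < k → ∃ g ∈ G, g ≠ 1 ∧ ∀ s ∈ S, g s = s)
    (h2 : ∀ φ ψ : Fin k → Fin n, Function.Injective φ → Function.Injective ψ →
        (∀ g ∈ G, (∀ i, g (φ i) = φ i) → g = 1) → (∀ g ∈ G, (∀ i, g (ψ i) = ψ i) → g = 1) →
        ∃ g ∈ G, ∀ i, g (φ i) = ψ i)
    (h3 : ∀ g ∈ G, ∃ y ∈ Y, ∃ y' ∈ Y, g = y * y'⁻¹) (hJ : JuntaSeparated n k X Y Z) :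
    X.card * Z.card ≤ n.choose k * n.choose k :=
  hH n k X Y Z G h1 h2 h3 hJ

/-- **Junta ⇒ floating-Garnir-certified** (depth 0). For the target `t` with junta frame `ι` (distinct-point set `U`,
`|U| = j ≤ k`), take a frame `(a, b)` with `b` mapping the tail positions `n-j, …, n-1` onto `U` and `a := sTop · b⁻¹ · t⁻¹`,
so that `a t b = sTop n j ∈ B_k`; a garbage product `g` read in this frame, `q = a g b = sTop · b⁻¹ t⁻¹ g b`, is NOT
Bruhat-above `sTop` — otherwise (J1) `q` agrees with `sTop` on the tail, i.e. `t⁻¹ g` fixes `U` pointwise, i.e.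
`g ∘ ι = t ∘ ι` — so `GarnirAvoid.incomparable` certifies it. -/
theorem floatingCertified_of_juntaSeparated (hT : TopCone) {n k : ℕ} (hkn : k ≤ n)
    {X Y Z : Finset (Equiv.Perm (Fin n))} (h : JuntaSeparated n k X Y Z) : FloatingCertified n k X Y Z := by
  classical
  refine ⟨hkn, fun x₀ hx₀ z₀ hz₀ => ?_⟩
  obtain ⟨ι, hι⟩ := h x₀ hx₀ z₀ hz₀
  set t : Equiv.Perm (Fin n) := x₀⁻¹ * z₀ with ht
  -- the distinct points of the frame and the tail positions
  set U : Finset (Fin n) := Finset.univ.image ι with hU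
  have hjk : U.card ≤ k := by
    calc U.card ≤ (Finset.univ : Finset (Fin k)).card := Finset.card_image_le
      _ = k := by simp
  have hjn : U.card ≤ n := by
    calc U.card ≤ (Finset.univ : Finset (Fin n)).card := Finset.card_le_univ U
      _ = n := by simp
  set T : Finset (Fin n) := Finset.univ.filter (fun a : Fin n => n - U.card ≤ (a : ℕ)) with hTdef
  have hTcard : T.card = U.card := by
    have h1 : (Finset.univ.filter (fun a : Fin n => (a : ℕ) < n - U.card)).card = n - U.card := by
      have := Fin.card_filter_val_lt (n := n) (m := n - U.card)
      simpa [Nat.min_eq_left (Nat.sub_le n U.card)] using this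
    have h2 : T = (Finset.univ.filter (fun a : Fin n => (a : ℕ) < n - U.card))ᶜ := by
      ext a; simp [hTdef, not_lt]
    rw [h2, Finset.card_compl, h1, Fintype.card_fin]
    omega
  -- a bijection `T ≃ U` and its extension to a permutation `b` of `Fin n`
  let e : T ≃ U := (T.equivFin.trans (finCongr hTcard)).trans U.equivFin.symm
  let f : Fin n → Fin n := fun a => if ha : a ∈ T then ((e ⟨a, ha⟩ : U) : Fin n) else a
  have hfT : T.image f ⊆ Finset.univ := Finset.subset_univ _
  have hfinj : Set.InjOn f T := by
    intro a ha a' ha' hfa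
    simp only [Finset.mem_coe] at ha ha'
    simp only [f, dif_pos ha, dif_pos ha'] at hfa
    have h1 : e ⟨a, ha⟩ = e ⟨a', ha'⟩ := Subtype.ext hfa
    have h2 := e.injective h1
    exact congrArg Subtype.val h2
  obtain ⟨g, hg⟩ := Finset.exists_equiv_extend_of_card_eq (t := (Finset.univ : Finset (Fin n)))
    (by simp) hfT hfinj
  let b : Equiv.Perm (Fin n) := g.trans (Equiv.subtypeUnivEquiv (fun a => Finset.mem_univ a))
  have hb : ∀ a (ha : a ∈ T), b a = ((e ⟨a, ha⟩ : U) : Fin n) := by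
    intro a ha
    show ((g a : Finset.univ) : Fin n) = _
    rw [hg a ha]
    simp only [f, dif_pos ha]
  have hbU : ∀ u ∈ U, ∃ a ∈ T, b a = u := by
    intro u hu
    refine ⟨((e.symm ⟨u, hu⟩ : T) : Fin n), (e.symm ⟨u, hu⟩).2, ?_⟩
    rw [hb _ (e.symm ⟨u, hu⟩).2]
    simp
  set a₀ : Equiv.Perm (Fin n) := sTop n U.card hjn * b⁻¹ * t⁻¹ with ha₀
  have hprod : a₀ * (x₀⁻¹ * z₀) * b = sTop n U.card hjn := by rw [ha₀, ← ht]; group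
  refine ⟨a₀, b, ?_, fun x hx y hy y' hy' z hz hne => ?_⟩
  · rw [hprod]
    exact sTop_mem_schenstedSet hjn hjk
  · apply GarnirAvoid.incomparable
    intro hle
    rw [hprod] at hle
    apply hι x hx y hy y' hy' z hz hne
    set g' : Equiv.Perm (Fin n) := x⁻¹ * y * y'⁻¹ * z with hg'
    have htail := tail_eq_of_bruhatLE_sTop hT hjn hle
    funext i
    simp only [Function.comp_apply]
    have hiU : ι i ∈ U := Finset.mem_image_of_mem ι (Finset.mem_univ i)
    obtain ⟨a, haT, hba⟩ := hbU (ι i) hiU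
    have haT' : n - U.card ≤ (a : ℕ) := by simpa [hTdef] using haT
    have h1 := htail a haT'
    have h2 : ((sTop n U.card hjn a : Fin n) : ℕ) = n - 1 - (a : ℕ) := by
      rw [sTop_apply_val, if_neg (by omega)]
    have h3 : (a₀ * g' * b) a = sTop n U.card hjn a := Fin.ext (by rw [h1, h2])
    have h4 : sTop n U.card hjn (b⁻¹ (t⁻¹ (g' (b a)))) = sTop n U.card hjn a := by
      simpa [ha₀, Equiv.Perm.mul_apply] using h3
    have h5 : b⁻¹ (t⁻¹ (g' (b a))) = a := (sTop n U.card hjn).injective h4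
    have h6 : t⁻¹ (g' (b a)) = b a := by
      have := congrArg b h5
      simpa using this
    have h7 : g' (b a) = t (b a) := by
      have := congrArg t h6
      simpa using this
    rw [← hba]
    exact h7

/-- `NearWall JuntaSeparated → FloatingDesigns`: the junta target is a SUB-target of the registered S6'. -/
theorem floatingDesigns_of_juntaDesigns (hT : TopCone) (h : NearWall JuntaSeparated) : FloatingDesigns := by
  intro δ hδ k₀
  obtain ⟨k, hk, n, X, Y, Z, hn, hJ, hV⟩ := h δ hδ k₀
  exact ⟨k, hk, n, X, Y, Z, hn, floatingCertified_of_juntaSeparated hT (by omega) hJ, hV⟩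


/-! ## K — the TWO-SET CORE (LEAD c2 RESHAPE 5)

Collapsing the middle set (`y = y'`) turns a separated triple into a separated PAIR: `(X, {1}, Z)` is `k`-token separated iff the
quotient map `(x, z) ↦ x⁻¹z` is injective on `X × Z` and the evaluation functionals `c ↦ f_c(x⁻¹z)` are linearly independent on the
coefficient tables (equivalently on `T_k`) — an INDEPENDENT PRODUCT SET of the level-`k` token matroid (rank `D_k`). Every
near-wall family of separated triples yields near-wall independent product pairs with balanced sides (K2); conversely the junta
(`k`-identifiable), fixed-set and Garnir certificates are sufficient conditions for independence. This is the common necessary core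
of all three lines, and the first thing a constructor must produce. -/

/-- **K1 `XZIndependence`** (registered stub, size M, provable now; finite-dimensional duality): for `X, Z ⊆ 𝔖ₙ`,
`KTokenSeparated n k X {1} Z` iff (i) `(x,z) ↦ x⁻¹z` is injective on `X ×ˢ Z` and (ii) the evaluation functionals
`c ↦ Σ_p c p ((x⁻¹z) ∘ p)` (`(x,z) ∈ X ×ˢ Z`), as elements of the ℂ-space of functions on coefficient tables, are linearly
independent. (→): apply a vanishing combination to the separator of `(x₀,z₀)`; injectivity because a separator takes different
values on two pairs with the same product. (←): independent functionals on a finite-dimensional space are jointly surjective onto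
`ℂ^{X×Z}` (the dual map of `c ↦ (ev_t c)_t` is injective), so the indicator of `(x₀,z₀)` is attained; with (i) it is the crux's
`0/1` pattern for `Y = {1}`. [cite: Disproof.lean `linearIndependent_of_dualPoints` (→ direction, landed
`Negative.DimensionWalls`); Mathlib `LinearMap.dualMap_injective_iff` / `Module.Dual`] -/
def XZIndependence : Prop :=
  ∀ (n k : ℕ) (X Z : Finset (Equiv.Perm (Fin n))),
    KTokenSeparated n k X {1} Z ↔
      (Set.InjOn (fun p : Equiv.Perm (Fin n) × Equiv.Perm (Fin n) => p.1⁻¹ * p.2) ↑(X ×ˢ Z) ∧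
        LinearIndependent ℂ (fun t : ↥(X ×ˢ Z) =>
          fun c : (Fin k → Fin n) → (Fin k → Fin n) → ℂ =>
            ∑ p : Fin k → Fin n, c p (⇑((t : Equiv.Perm (Fin n) × Equiv.Perm (Fin n)).1⁻¹ *
              (t : Equiv.Perm (Fin n) × Equiv.Perm (Fin n)).2) ∘ p)))

/-- Registered stub K1 (statement = `XZIndependence`, tree-only vocabulary: `KTokenSeparated n k X {1} Z` unfolded). -/
theorem stub_xzIndependence :
    ∀ (n k : ℕ) (X Z : Finset (Equiv.Perm (Fin n))),
      (∀ x₀ ∈ X, ∀ z₀ ∈ Z, ∃ c : (Fin k → Fin n) → (Fin k → Fin n) → ℂ,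
          ∀ x ∈ X, ∀ y ∈ ({1} : Finset (Equiv.Perm (Fin n))), ∀ y' ∈ ({1} : Finset (Equiv.Perm (Fin n))),
            ∀ z ∈ Z, (∑ p : Fin k → Fin n, c p (⇑(x⁻¹ * y * y'⁻¹ * z) ∘ p)) =
              if x = x₀ ∧ y = y' ∧ z = z₀ then 1 else 0) ↔
        (Set.InjOn (fun p : Equiv.Perm (Fin n) × Equiv.Perm (Fin n) => p.1⁻¹ * p.2) ↑(X ×ˢ Z) ∧
          LinearIndependent ℂ (fun t : ↥(X ×ˢ Z) =>
            fun c : (Fin k → Fin n) → (Fin k → Fin n) → ℂ =>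
              ∑ p : Fin k → Fin n, c p (⇑((t : Equiv.Perm (Fin n) × Equiv.Perm (Fin n)).1⁻¹ *
                (t : Equiv.Perm (Fin n) × Equiv.Perm (Fin n)).2) ∘ p))) :=
  Summit.MatrixMultiplication.MatrixMultiplication.Theorems.SnLevelDesigns.stub_xzIndependence

/-- **Near-wall independent product PAIRS** (the two-set target): for every `δ > 0` and arbitrarily large `k` some `n ≥ 3k` carries
`X, Z ⊆ 𝔖ₙ` with `(X, {1}, Z)` `k`-token separated (injective + independent, K1), `D_k ≤ e^{δ√k}·|X||Z|` and balanced sides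
`|X|, |Z| ≤ e^{δ√k}·√D_k`. NECESSARY for `NearWall P` whenever `P` implies separation (K2); the open two-set problem of the crux. -/
def NearWallPair : Prop :=
  ∀ δ : ℝ, 0 < δ → ∀ k₀ : ℕ, ∃ k : ℕ, k₀ ≤ k ∧ ∃ (n : ℕ) (X Z : Finset (Equiv.Perm (Fin n))),
    3 * k ≤ n ∧ KTokenSeparated n k X {1} Z ∧
      ((levelDim n k : ℕ) : ℝ) ≤ Real.exp (δ * Real.sqrt (k : ℝ)) * ((X.card * Z.card : ℕ) : ℝ) ∧
      ((X.card : ℕ) : ℝ) ≤ Real.exp (δ * Real.sqrt (k : ℝ)) * Real.sqrt ((levelDim n k : ℕ) : ℝ) ∧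
      ((Z.card : ℕ) : ℝ) ≤ Real.exp (δ * Real.sqrt (k : ℝ)) * Real.sqrt ((levelDim n k : ℕ) : ℝ)

/-- **K2 `TwoSetCore`** (registered stub, size M, provable now): for any property `P` implying `k`-token separation,
`NearWall P → NearWallPair`. Proof: take the `NearWall` member at `δ/2`; `D_k ≥ 1` (the trivial partition pays `1`) forces
`V > 0`, so `X, Y, Z ≠ ∅`; the three walls `|X||Y|, |Y||Z|, |X||Z| ≤ dim T_k ≤ D_k` (landed `Negative.DimensionWalls` +
`LevelGradedCohnUmansTokenWall.finrank_tokenSpace_le`) give `V² = (|X||Y|)(|Y||Z|)(|X||Z|) ≤ D_k²·|X||Z|`, hence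
`|X||Z| ≥ e^{-δ√k} D_k`, and `|X| ≤ D_k/|Y|`, `|Y| ≥ V/(|X||Z|) ≥ e^{-(δ/2)√k}√D_k` give `|X| ≤ e^{(δ/2)√k}√D_k` (same for
`|Z|`); finally separation restricts to the sub-triple `(X, {y₁}, Z)`, which is `(X, {1}, Z)` verbatim (`x⁻¹y₁y₁⁻¹z = x⁻¹z`). -/
def TwoSetCore : Prop :=
  ∀ P : (n : ℕ) → ℕ → Finset (Equiv.Perm (Fin n)) → Finset (Equiv.Perm (Fin n)) →
      Finset (Equiv.Perm (Fin n)) → Prop,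
    (∀ (n k : ℕ) (X Y Z : Finset (Equiv.Perm (Fin n))), P n k X Y Z → KTokenSeparated n k X Y Z) →
      NearWall P → NearWallPair

/-- Registered stub K2 (statement = `TwoSetCore`, tree-only vocabulary). -/
theorem stub_twoSetCore :
    ∀ P : (n : ℕ) → ℕ → Finset (Equiv.Perm (Fin n)) → Finset (Equiv.Perm (Fin n)) →
        Finset (Equiv.Perm (Fin n)) → Prop,
      (∀ (n k : ℕ) (X Y Z : Finset (Equiv.Perm (Fin n))), P n k X Y Z →
          ∀ x₀ ∈ X, ∀ z₀ ∈ Z, ∃ c : (Fin k → Fin n) → (Fin k → Fin n) → ℂ,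
            ∀ x ∈ X, ∀ y ∈ Y, ∀ y' ∈ Y, ∀ z ∈ Z,
              (∑ p : Fin k → Fin n, c p (⇑(x⁻¹ * y * y'⁻¹ * z) ∘ p)) = if x = x₀ ∧ y = y' ∧ z = z₀ then 1 else 0) →
      (∀ δ : ℝ, 0 < δ → ∀ k₀ : ℕ, ∃ k : ℕ, k₀ ≤ k ∧ ∃ (n : ℕ) (X Y Z : Finset (Equiv.Perm (Fin n))),
          3 * k ≤ n ∧ P n k X Y Z ∧
            ((∑ μ : Nat.Partition n, if n - k ≤ μ.parts.sup then
                Literature.NumberTheory.DiophantineGeometry.numStandardTableaux μ ^ 2 else 0 : ℕ) : ℝ) ^ ((3 : ℝ) / 2) ≤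
              Real.exp (δ * Real.sqrt (k : ℝ)) * ((X.card * Y.card * Z.card : ℕ) : ℝ)) →
      ∀ δ : ℝ, 0 < δ → ∀ k₀ : ℕ, ∃ k : ℕ, k₀ ≤ k ∧ ∃ (n : ℕ) (X Z : Finset (Equiv.Perm (Fin n))),
        3 * k ≤ n ∧
          (∀ x₀ ∈ X, ∀ z₀ ∈ Z, ∃ c : (Fin k → Fin n) → (Fin k → Fin n) → ℂ,
            ∀ x ∈ X, ∀ y ∈ ({1} : Finset (Equiv.Perm (Fin n))), ∀ y' ∈ ({1} : Finset (Equiv.Perm (Fin n))),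
              ∀ z ∈ Z, (∑ p : Fin k → Fin n, c p (⇑(x⁻¹ * y * y'⁻¹ * z) ∘ p)) =
                if x = x₀ ∧ y = y' ∧ z = z₀ then 1 else 0) ∧
          ((∑ μ : Nat.Partition n, if n - k ≤ μ.parts.sup then
              Literature.NumberTheory.DiophantineGeometry.numStandardTableaux μ ^ 2 else 0 : ℕ) : ℝ) ≤
            Real.exp (δ * Real.sqrt (k : ℝ)) * ((X.card * Z.card : ℕ) : ℝ) ∧
          ((X.card : ℕ) : ℝ) ≤ Real.exp (δ * Real.sqrt (k : ℝ)) *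
            Real.sqrt ((∑ μ : Nat.Partition n, if n - k ≤ μ.parts.sup then
              Literature.NumberTheory.DiophantineGeometry.numStandardTableaux μ ^ 2 else 0 : ℕ) : ℝ) ∧
          ((Z.card : ℕ) : ℝ) ≤ Real.exp (δ * Real.sqrt (k : ℝ)) *
            Real.sqrt ((∑ μ : Nat.Partition n, if n - k ≤ μ.parts.sup then
              Literature.NumberTheory.DiophantineGeometry.numStandardTableaux μ ^ 2 else 0 : ℕ) : ℝ) :=
  Summit.MatrixMultiplication.MatrixMultiplication.Theorems.SnLevelDesigns.stub_twoSetCore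

/-- K2 in this file's vocabulary. -/
theorem nearWallPair_of_nearWall (hK : TwoSetCore)
    {P : (n : ℕ) → ℕ → Finset (Equiv.Perm (Fin n)) → Finset (Equiv.Perm (Fin n)) → Finset (Equiv.Perm (Fin n)) → Prop}
    (hP : ∀ (n k : ℕ) (X Y Z : Finset (Equiv.Perm (Fin n))), P n k X Y Z → KTokenSeparated n k X Y Z)
    (h : NearWall P) : NearWallPair :=
  hK P hP h

/-- **K3 `HubPairs`** (registered stub, LEAD c2; size M–L, provable now — the EXPLICIT baseline of the two-set core): for all
`m, k`, inside `𝔖_{2m+k}` (letters `A = {0,…,m-1}`, `B = {m,…,2m-1}`, hubs `h_i = 2m+i`, `i < k`) the pair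
`X := {ξ_S = Π_i (s_i h_i) : S = {s_1 < ⋯ < s_k} ⊆ A}` (involutions, so `x⁻¹ = x`), `Z := {ζ_b = Π_i (b_i h_i) : b : Fin k ↪ B}` is
XZ-JUNTA with the floating frame `ι := b⁰` at the target `(ξ_{S⁰}, ζ_{b⁰})`: `(ξ_S ζ_b)(b⁰_i) = s_j` if `b⁰_i = b_j` and `= b⁰_i ∈ B`
otherwise, so agreement with the target values `s⁰_i ∈ A` on all of `ι` forces `b = b⁰ ∘ π` and `s ∘ π = s⁰`, whence `π = 1` (both
`s, s⁰` increasing). Sizes `|X| = C(m,k)`, `|Z| = (m)_k`, so `|X||Z| = C(m,k)(m)_k = Λ_k(m) ≈ 4^{-k}Λ_k(n)`: an explicit family of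
`k`-identifiable (hence token-independent, depth-0 floating-Garnir-certified) balanced-up-to-`k!` product pairs at every level, a
factor `4^{-k}` under the wall (hub gadget with a per-side alphabet split; see `TwoSetCore-c2.md` §2 for why the split is what costs). -/
def HubPairs : Prop :=
  ∀ (m k : ℕ), ∃ X Z : Finset (Equiv.Perm (Fin (2 * m + k))),
    X.card = m.choose k ∧ Z.card = m.descFactorial k ∧
      ∀ x₀ ∈ X, ∀ z₀ ∈ Z, ∃ ι : Fin k → Fin (2 * m + k), ∀ x ∈ X, ∀ z ∈ Z,
        ¬ (x = x₀ ∧ z = z₀) → (⇑(x⁻¹ * z)) ∘ ι ≠ (⇑(x₀⁻¹ * z₀)) ∘ ι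

/-- Registered stub K3 (statement = `HubPairs`, tree-only vocabulary). -/
theorem stub_hubPairs :
    ∀ (m k : ℕ), ∃ X Z : Finset (Equiv.Perm (Fin (2 * m + k))),
      X.card = m.choose k ∧ Z.card = m.descFactorial k ∧
        ∀ x₀ ∈ X, ∀ z₀ ∈ Z, ∃ ι : Fin k → Fin (2 * m + k), ∀ x ∈ X, ∀ z ∈ Z,
          ¬ (x = x₀ ∧ z = z₀) → (⇑(x⁻¹ * z)) ∘ ι ≠ (⇑(x₀⁻¹ * z₀)) ∘ ι := by
  -- LANDED p110856 (`Theorems.SnLevelDesigns.stub_hubPairs`); replaced by the import as soon as the farm snapshot has built that module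
  sorry

/-- K3 ⇒ explicit XZ-junta pairs with `|X|·|Z| = C(m,k)·(m)_k` in `𝔖_{2m+k}`; with J4(b) the number of frames they use is at least
`C(m,k)(m)_k / (2m+k)^k`. -/
theorem exists_xzJunta_pairs (hH : HubPairs) (m k : ℕ) :
    ∃ X Z : Finset (Equiv.Perm (Fin (2 * m + k))), X.card * Z.card = m.choose k * m.descFactorial k ∧
      ∀ x₀ ∈ X, ∀ z₀ ∈ Z, ∃ ι : Fin k → Fin (2 * m + k), ∀ x ∈ X, ∀ z ∈ Z,
        ¬ (x = x₀ ∧ z = z₀) → (⇑(x⁻¹ * z)) ∘ ι ≠ (⇑(x₀⁻¹ * z₀)) ∘ ι := by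
  obtain ⟨X, Z, hX, hZ, h⟩ := hH m k
  exact ⟨X, Z, by rw [hX, hZ], h⟩

/-- **K4 `HubTriples`** (registered stub, LEAD c2; size L, provable now — TRANSFER from TPP in `𝔖_k`): the three-alphabet hub
gadget turns every TPP triple of PATTERN classes `P₁, P₂, P₃ ⊆ 𝔖_k` (left-quotient form: `α⁻¹α'·γ⁻¹γ'·β⁻¹β' = 1 ⇒ α = α', γ = γ',
β = β'` for `α,α' ∈ P₁`, `γ,γ' ∈ P₂`, `β,β' ∈ P₃`) into a JUNTA-separated triple in `𝔖_{3m+k}` (letters `A = [0,m)`, `B = [m,2m)`,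
`C = [2m,3m)`, hubs `h_i = 3m+i`): `X⁻¹ = {ξ_{s∘α}}`, `Y = {η_{v∘γ}}`, `Z = {ζ_{u∘β}}` with `s, v, u` increasing `k`-selections
from `A, C, B` and `α ∈ P₁, γ ∈ P₂, β ∈ P₃` (each gadget the involution swapping `h_i` with its `i`-th letter), frame `ι = u⁰∘β⁰`
(the B-letters of `z₀`): the garbage value `ξ_a η_c η_{c'} ζ_b (b⁰_i)` is a B- or C-letter unless `b⁰ = b∘J`, `c'∘J = c∘L`,
`a⁰ = a∘L` for bijections `J, L` of the indices, and then `α⁻¹α⁰ = γ⁻¹γ'·β⁻¹β⁰`, which TPP makes trivial. Sizes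
`|X| = C(m,k)|P₁|`, `|Y| = C(m,k)|P₂|`, `|Z| = C(m,k)|P₃|`, so `V = C(m,k)³|P₁||P₂||P₃| ≤ C(m,k)³(k!)^{3/2} ≈ 27^{-k}D_k^{3/2}`:
level-`k` hub designs in `𝔖_n` are exactly as good as TPP packings in `𝔖_k`, times the alphabet loss — an explicit infinite
family of junta (hence `k`-token-separated) TRIPLES from every TPP triple in `𝔖_k` (e.g. `P₁ = 𝔖_k`, `P₂ = P₃ = {1}`), and a
second reason (besides the `27^{-k}`) why this architecture cannot reach the wall. -/
def HubTriples : Prop :=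
  ∀ (m k : ℕ) (P₁ P₂ P₃ : Finset (Equiv.Perm (Fin k))),
    (∀ α ∈ P₁, ∀ α' ∈ P₁, ∀ γ ∈ P₂, ∀ γ' ∈ P₂, ∀ β ∈ P₃, ∀ β' ∈ P₃,
        α⁻¹ * α' * (γ⁻¹ * γ') * (β⁻¹ * β') = 1 → α = α' ∧ γ = γ' ∧ β = β') →
    ∃ X Y Z : Finset (Equiv.Perm (Fin (3 * m + k))),
      X.card = m.choose k * P₁.card ∧ Y.card = m.choose k * P₂.card ∧ Z.card = m.choose k * P₃.card ∧
        ∀ x₀ ∈ X, ∀ z₀ ∈ Z, ∃ ι : Fin k → Fin (3 * m + k), ∀ x ∈ X, ∀ y ∈ Y, ∀ y' ∈ Y, ∀ z ∈ Z,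
          ¬ (x = x₀ ∧ y = y' ∧ z = z₀) → (⇑(x⁻¹ * y * y'⁻¹ * z)) ∘ ι ≠ (⇑(x₀⁻¹ * z₀)) ∘ ι

/-- Registered stub K4 (statement = `HubTriples`, tree-only vocabulary). -/
theorem stub_hubTriples :
    ∀ (m k : ℕ) (P₁ P₂ P₃ : Finset (Equiv.Perm (Fin k))),
      (∀ α ∈ P₁, ∀ α' ∈ P₁, ∀ γ ∈ P₂, ∀ γ' ∈ P₂, ∀ β ∈ P₃, ∀ β' ∈ P₃,
          α⁻¹ * α' * (γ⁻¹ * γ') * (β⁻¹ * β') = 1 → α = α' ∧ γ = γ' ∧ β = β') →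
      ∃ X Y Z : Finset (Equiv.Perm (Fin (3 * m + k))),
        X.card = m.choose k * P₁.card ∧ Y.card = m.choose k * P₂.card ∧ Z.card = m.choose k * P₃.card ∧
          ∀ x₀ ∈ X, ∀ z₀ ∈ Z, ∃ ι : Fin k → Fin (3 * m + k), ∀ x ∈ X, ∀ y ∈ Y, ∀ y' ∈ Y, ∀ z ∈ Z,
            ¬ (x = x₀ ∧ y = y' ∧ z = z₀) → (⇑(x⁻¹ * y * y'⁻¹ * z)) ∘ ι ≠ (⇑(x₀⁻¹ * z₀)) ∘ ι := by
  -- LANDED p112737 (`Theorems.SnLevelDesigns.stub_hubTriples`); replaced by the import as soon as the farm snapshot has built that module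
  sorry

/-- K4 at the trivial TPP triple `(𝔖_k, {1}, {1})`: explicit junta-separated TRIPLES in `𝔖_{3m+k}` with
`|X| = C(m,k)·k!`, `|Y| = |Z| = C(m,k)` for all `m, k`. -/
theorem exists_junta_triples (hH : HubTriples) (m k : ℕ) :
    ∃ X Y Z : Finset (Equiv.Perm (Fin (3 * m + k))),
      X.card = m.choose k * (Nat.factorial k) ∧ Y.card = m.choose k ∧ Z.card = m.choose k ∧
        JuntaSeparated (3 * m + k) k X Y Z := by
  classical
  obtain ⟨X, Y, Z, hX, hY, hZ, h⟩ := hH m k Finset.univ {1} {1} (by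
    intro α _ α' _ γ hγ γ' hγ' β hβ β' hβ' hprod
    rw [Finset.mem_singleton] at hγ hγ' hβ hβ'
    subst hγ hγ' hβ hβ'
    refine ⟨?_, rfl, rfl⟩
    have h1 : α⁻¹ * α' = 1 := by simpa using hprod
    rw [inv_mul_eq_one] at h1
    exact h1)
  refine ⟨X, Y, Z, ?_, by simpa using hY, by simpa using hZ, h⟩
  rw [hX, Finset.card_univ, Fintype.card_perm, Fintype.card_fin]

/-! ## J4 — floating-frame counts (LEAD c2 RESHAPE 5) -/

/-- **J4 `FloatingFrameCount`** (registered stub, size S–M, provable now). (a) THE MIDDLE FLOATS TOO: if the targets `(x₀, z₀)`,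
`z₀ ∈ Z`, of one row are junta-separated from their `x = x₀` garbage with frames `U z₀`, then `(y, z) ↦ (U z, (y⁻¹z) ∘ U z)` is
injective on `Y × Z` (two pairs with the same frame `ι` and `(y⁻¹z) ∘ ι = (y'⁻¹z') ∘ ι` give the garbage `(x₀, y, y', z')` of the
target `(x₀, z)` agreeing with it on `ι`), so `|Y|·|Z| ≤ #{U z : z ∈ Z}·n^k`: at the near-wall scale `|Y||Z| ≈ D_k ≈ n^{2k}/k!`
every row uses `≳ C(n,k)·e^{-δ√k}` distinct frames. (b) The label form of J2: with target-dependent frames `U x₀ z₀`, the map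
`(x, z) ↦ (U x z, (x⁻¹z) ∘ U x z)` is injective, so `|X|·|Z| ≤ #{frames used}·n^k` (J2 = one frame). -/
def FloatingFrameCount : Prop :=
  (∀ (n k : ℕ) (Y Z : Finset (Equiv.Perm (Fin n))) (x₀ : Equiv.Perm (Fin n))
      (U : Equiv.Perm (Fin n) → (Fin k → Fin n)),
    (∀ z₀ ∈ Z, ∀ y ∈ Y, ∀ y' ∈ Y, ∀ z ∈ Z, ¬ (y = y' ∧ z = z₀) →
        (⇑(x₀⁻¹ * y * y'⁻¹ * z)) ∘ (U z₀) ≠ (⇑(x₀⁻¹ * z₀)) ∘ (U z₀)) →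
    Y.card * Z.card ≤ (Z.image U).card * n ^ k) ∧
  (∀ (n k : ℕ) (X Z : Finset (Equiv.Perm (Fin n)))
      (U : Equiv.Perm (Fin n) → Equiv.Perm (Fin n) → (Fin k → Fin n)),
    (∀ x₀ ∈ X, ∀ z₀ ∈ Z, ∀ x ∈ X, ∀ z ∈ Z, ¬ (x = x₀ ∧ z = z₀) →
        (⇑(x⁻¹ * z)) ∘ (U x₀ z₀) ≠ (⇑(x₀⁻¹ * z₀)) ∘ (U x₀ z₀)) →
    X.card * Z.card ≤ ((X ×ˢ Z).image (fun p => U p.1 p.2)).card * n ^ k)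

/-- Registered stub J4 (statement = `FloatingFrameCount`, tree-only vocabulary). -/
theorem stub_floatingFrameCount :
    (∀ (n k : ℕ) (Y Z : Finset (Equiv.Perm (Fin n))) (x₀ : Equiv.Perm (Fin n))
        (U : Equiv.Perm (Fin n) → (Fin k → Fin n)),
      (∀ z₀ ∈ Z, ∀ y ∈ Y, ∀ y' ∈ Y, ∀ z ∈ Z, ¬ (y = y' ∧ z = z₀) →
          (⇑(x₀⁻¹ * y * y'⁻¹ * z)) ∘ (U z₀) ≠ (⇑(x₀⁻¹ * z₀)) ∘ (U z₀)) →
      Y.card * Z.card ≤ (Z.image U).card * n ^ k) ∧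
    (∀ (n k : ℕ) (X Z : Finset (Equiv.Perm (Fin n)))
        (U : Equiv.Perm (Fin n) → Equiv.Perm (Fin n) → (Fin k → Fin n)),
      (∀ x₀ ∈ X, ∀ z₀ ∈ Z, ∀ x ∈ X, ∀ z ∈ Z, ¬ (x = x₀ ∧ z = z₀) →
          (⇑(x⁻¹ * z)) ∘ (U x₀ z₀) ≠ (⇑(x₀⁻¹ * z₀)) ∘ (U x₀ z₀)) →
      X.card * Z.card ≤ ((X ×ˢ Z).image (fun p => U p.1 p.2)).card * n ^ k) :=
  Summit.MatrixMultiplication.MatrixMultiplication.Theorems.SnLevelDesigns.stub_floatingFrameCount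

/-- J4(a) for a junta design: every row `x₀` uses at least `|Y||Z|/n^k` distinct frames. -/
theorem card_mul_card_le_frames_row (hF : FloatingFrameCount) {n k : ℕ} {X Y Z : Finset (Equiv.Perm (Fin n))}
    (U : Equiv.Perm (Fin n) → Equiv.Perm (Fin n) → (Fin k → Fin n))
    (hU : ∀ x₀ ∈ X, ∀ z₀ ∈ Z, ∀ x ∈ X, ∀ y ∈ Y, ∀ y' ∈ Y, ∀ z ∈ Z,
      ¬ (x = x₀ ∧ y = y' ∧ z = z₀) → (⇑(x⁻¹ * y * y'⁻¹ * z)) ∘ (U x₀ z₀) ≠ (⇑(x₀⁻¹ * z₀)) ∘ (U x₀ z₀))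
    {x₀ : Equiv.Perm (Fin n)} (hx₀ : x₀ ∈ X) :
    Y.card * Z.card ≤ (Z.image (U x₀)).card * n ^ k :=
  hF.1 n k Y Z x₀ (U x₀) fun z₀ hz₀ y hy y' hy' z hz hne =>
    hU x₀ hx₀ z₀ hz₀ x₀ hx₀ y hy y' hy' z hz (fun h => hne ⟨h.2.1, h.2.2⟩)


/-! ## M — the LINEAR CRITERION and the middle-set tests (LEAD c3 RESHAPE 6)

Separation is a statement about the EVALUATION FUNCTIONALS `ev_g : c ↦ Σ_p c p (g ∘ p)` on coefficient tables (equivalently about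
the images `π(g)` of group elements in the level-`k` algebra `A_k = ℂ𝔖ₙ/T_k^⊥ ≅ ⊕_{λ₁ ≥ n-k} End V_λ`, `dim A_k = D_k`): a triple is
`k`-token separated iff for every target the functional `ev_{x₀⁻¹z₀}` lies OUTSIDE the span of the functionals of its garbage products
(M1, the refuter's GENERAL FORM made exact; K1 is the case `Y = {1}`). Two one-target shadows follow: the middle difference set must pass the
IDENTITY TEST `ev_1 ∉ span{ev_{yy'⁻¹} : y ≠ y'}` (M2 — the `𝔖ₙ`-engine form of the route's lever (L1)), hence can contain no Young subgroup
of excess `≥ k+1` (M3, from S1). Lead c3's numerics (`Cruxes/SnLevelDesigns/TwoSetGeneric-c3.md`): for RANDOM balanced `X, Z` the product set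
`X⁻¹Z` is token-independent up to `|X||Z| = D_k - 1` (levels 1–3), so the two-set core K2 is generically satisfiable and all difficulty of S6' is
the coupling through `Y`: generic position forces `|X||Y|²|Z| ≲ D_k`, so the quadruple-product set must be massively DEPENDENT in the token
matroid (group coincidences = full-budget TPP structure, or level-`k` Garnir relations) while `X⁻¹Z` stays independent outside its span. -/

/-- The evaluation functional of `g` on level-`k` coefficient tables: `ev g = (c ↦ Σ_{p : [k] → [n]} c p (g ∘ p))` (`= c ↦ tokenFn c g`). -/
def ev (n k : ℕ) (g : Equiv.Perm (Fin n)) : ((Fin k → Fin n) → (Fin k → Fin n) → ℂ) → ℂ :=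
  fun c => ∑ p : Fin k → Fin n, c p (⇑g ∘ p)

/-- The garbage products of the target `(x₀, z₀)`: all `x⁻¹ y y'⁻¹ z` over `X × Y × Y × Z` except the target quadruples
`(x₀, y, y, z₀)`. -/
def garbage (X Y Z : Finset (Equiv.Perm (Fin n))) (x₀ z₀ : Equiv.Perm (Fin n)) : Set (Equiv.Perm (Fin n)) :=
  {g | ∃ x ∈ X, ∃ y ∈ Y, ∃ y' ∈ Y, ∃ z ∈ Z, ¬ (x = x₀ ∧ y = y' ∧ z = z₀) ∧ g = x⁻¹ * y * y'⁻¹ * z}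

/-- **M1 `LinearCriterion`** (registered stub, LEAD c3; size M; LANDED in corrected form — finite-dimensional duality, as in K1): for
`Y ≠ ∅` (the registered hypothesis-free form was false at `n = 0 < k`, `Y = ∅`, where every `ev` is `0`), `(X, Y, Z)` is
`k`-token separated iff for every target `(x₀, z₀)` the evaluation functional `ev (x₀⁻¹z₀)` is NOT in the `ℂ`-span of the evaluation
functionals of its garbage products. (→): apply a spanning combination to the separator `c` (evaluation at `c` is linear; the separator is
`1` at the target and `0` on the garbage). (←): the linear map `c ↦ (ev t c, (ev g c)_{g ∈ garbage})` into the finite-dimensional space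
`ℂ^{1 + #garbage}` has the first basis vector in its range — otherwise a functional vanishing on the range with non-zero first coordinate
writes `ev t` as a combination of the `ev g` — and a preimage is the crux's separator (targets all have product `x₀⁻¹z₀`).
[cite: `Theorems/LevelGradedCohnUmansSnLevelDesignsStubXzIndependence.lean` (K1, p109071: the case `Y = {1}`); Mathlib
`Submodule.span_induction`, `LinearMap.exists_ne_zero_mem_ker_of_…`/`Module.Dual`] -/
def LinearCriterion : Prop :=
  ∀ (n k : ℕ) (X Y Z : Finset (Equiv.Perm (Fin n))), Y.Nonempty →
    (KTokenSeparated n k X Y Z ↔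
      ∀ x₀ ∈ X, ∀ z₀ ∈ Z, ev n k (x₀⁻¹ * z₀) ∉ Submodule.span ℂ (ev n k '' garbage X Y Z x₀ z₀))

/-- Registered stub M1 (statement = `LinearCriterion`, tree-only vocabulary: `KTokenSeparated`, `ev`, `garbage` unfolded). -/
theorem stub_linearCriterion :
    ∀ (n k : ℕ) (X Y Z : Finset (Equiv.Perm (Fin n))), Y.Nonempty →
      ((∀ x₀ ∈ X, ∀ z₀ ∈ Z, ∃ c : (Fin k → Fin n) → (Fin k → Fin n) → ℂ,
          ∀ x ∈ X, ∀ y ∈ Y, ∀ y' ∈ Y, ∀ z ∈ Z,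
            (∑ p : Fin k → Fin n, c p (⇑(x⁻¹ * y * y'⁻¹ * z) ∘ p)) = if x = x₀ ∧ y = y' ∧ z = z₀ then 1 else 0) ↔
        ∀ x₀ ∈ X, ∀ z₀ ∈ Z,
          (fun c : (Fin k → Fin n) → (Fin k → Fin n) → ℂ => ∑ p : Fin k → Fin n, c p (⇑(x₀⁻¹ * z₀) ∘ p)) ∉
            Submodule.span ℂ
              ((fun g : Equiv.Perm (Fin n) =>
                  fun c : (Fin k → Fin n) → (Fin k → Fin n) → ℂ => ∑ p : Fin k → Fin n, c p (⇑g ∘ p)) ''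
                {g | ∃ x ∈ X, ∃ y ∈ Y, ∃ y' ∈ Y, ∃ z ∈ Z,
                  ¬ (x = x₀ ∧ y = y' ∧ z = z₀) ∧ g = x⁻¹ * y * y'⁻¹ * z})) := by
  -- LANDED (proposal pending) (`Theorems.SnLevelDesigns.stub_linearCriterion`); replaced by the import as soon as the farm snapshot has built that module
  sorry

/-- **M2 `MiddleIdentityTest`** (registered stub, LEAD c3; size S–M; LANDED p116594 in corrected form, `Y ≠ ∅` added — the `Y = ∅, n = 0 < k`
corner is false as for M1): if `(X, Y, Z)` is `k`-token separated and `X, Y, Z ≠ ∅`,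
then the middle DIFFERENCE SET passes the identity test: `ev 1 ∉ span{ev (y y'⁻¹) : y ≠ y' ∈ Y}`. Proof: pick a target `(x₀, z₀)` and its
separator `c`; by two-sided translation invariance (`tokenFn_translate`: `ev g c' = ev (x₀⁻¹ g z₀) c` for the re-indexed table
`c' p q := c (z₀⁻¹ ∘ p) (x₀⁻¹ ∘ q)`) the table `c'` has `ev 1 c' = 1` and `ev (yy'⁻¹) c' = 0` for `y ≠ y'` (garbage `(x₀, y, y', z₀)`);
evaluate a spanning combination at `c'`. This is the `𝔖ₙ`-engine form of the route's SUBGROUP IDENTITY TEST: a middle set `Y` inside a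
subgroup `H` needs every irreducible of `H` met by `YY⁻¹` to be visible in the permutation module of `H` on `k`-frames. -/
def MiddleIdentityTest : Prop :=
  ∀ (n k : ℕ) (X Y Z : Finset (Equiv.Perm (Fin n))), X.Nonempty → Z.Nonempty → Y.Nonempty →
    KTokenSeparated n k X Y Z →
    ev n k 1 ∉ Submodule.span ℂ (ev n k '' {g | ∃ y ∈ Y, ∃ y' ∈ Y, y ≠ y' ∧ g = y * y'⁻¹})

/-- Registered stub M2 (statement = `MiddleIdentityTest`, tree-only vocabulary). -/
theorem stub_middleIdentityTest :
    ∀ (n k : ℕ) (X Y Z : Finset (Equiv.Perm (Fin n))), X.Nonempty → Z.Nonempty → Y.Nonempty →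
      (∀ x₀ ∈ X, ∀ z₀ ∈ Z, ∃ c : (Fin k → Fin n) → (Fin k → Fin n) → ℂ,
          ∀ x ∈ X, ∀ y ∈ Y, ∀ y' ∈ Y, ∀ z ∈ Z,
            (∑ p : Fin k → Fin n, c p (⇑(x⁻¹ * y * y'⁻¹ * z) ∘ p)) = if x = x₀ ∧ y = y' ∧ z = z₀ then 1 else 0) →
        (fun c : (Fin k → Fin n) → (Fin k → Fin n) → ℂ => ∑ p : Fin k → Fin n, c p p) ∉
          Submodule.span ℂ
            ((fun g : Equiv.Perm (Fin n) =>
                fun c : (Fin k → Fin n) → (Fin k → Fin n) → ℂ => ∑ p : Fin k → Fin n, c p (⇑g ∘ p)) ''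
              {g | ∃ y ∈ Y, ∃ y' ∈ Y, y ≠ y' ∧ g = y * y'⁻¹}) := by
  -- LANDED p116594 (`Theorems.SnLevelDesigns.stub_middleIdentityTest`); replaced by the import as soon as the farm snapshot has built that module
  sorry

/-- **M3 `GarnirFreeMiddle`** (registered stub, LEAD c3; size S; LANDED p116407, from the landed S1 `stub_garnirVanishing`): if `(X, Y, Z)` is
`k`-token separated with `X, Z ≠ ∅`, then the middle difference set `YY⁻¹` contains NO Young subgroup `blockStab blk` of excess `≥ k+1`
(e.g. no elementary abelian `⟨k+1 disjoint transpositions⟩`, no `Sym` of `k+2` points). Proof: if `blockStab blk ⊆ YY⁻¹`, the Garnir sum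
`Σ_{σ ∈ blockStab blk} sgn(σ)·f_c(x₀⁻¹ σ z₀)` vanishes (S1 with `a = x₀⁻¹`, `b = z₀`), yet its terms are `[σ = 1]` for the separator `c` of
`(x₀, z₀)` (`σ = yy'⁻¹ ≠ 1` is the garbage `(x₀, y, y', z₀)`), so it equals `1`. The difference-set form of the card's kill-test
`not_separated_of_coset_subset` (which needs a whole coset INSIDE `Y`). [cite: S1 p79352; Disproof.lean `exists_coset_point_not_mem_quot`] -/
def GarnirFreeMiddle : Prop :=
  ∀ (n k : ℕ) (X Y Z : Finset (Equiv.Perm (Fin n))) (blk : Fin n → Fin n),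
    numBlocks blk + k + 1 ≤ n → X.Nonempty → Z.Nonempty → KTokenSeparated n k X Y Z →
      ¬ (∀ σ ∈ blockStab blk, ∃ y ∈ Y, ∃ y' ∈ Y, σ = y * y'⁻¹)

/-- Registered stub M3 (statement = `GarnirFreeMiddle`, tree-only vocabulary). -/
theorem stub_garnirFreeMiddle :
    ∀ (n k : ℕ) (X Y Z : Finset (Equiv.Perm (Fin n))) (blk : Fin n → Fin n),
      (Finset.univ.image blk).card + k + 1 ≤ n → X.Nonempty → Z.Nonempty →
        (∀ x₀ ∈ X, ∀ z₀ ∈ Z, ∃ c : (Fin k → Fin n) → (Fin k → Fin n) → ℂ,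
            ∀ x ∈ X, ∀ y ∈ Y, ∀ y' ∈ Y, ∀ z ∈ Z,
              (∑ p : Fin k → Fin n, c p (⇑(x⁻¹ * y * y'⁻¹ * z) ∘ p)) = if x = x₀ ∧ y = y' ∧ z = z₀ then 1 else 0) →
          ¬ (∀ σ ∈ Finset.univ.filter (fun σ : Equiv.Perm (Fin n) => ∀ a, blk (σ a) = blk a),
              ∃ y ∈ Y, ∃ y' ∈ Y, σ = y * y'⁻¹) := by
  -- LANDED p116407 (`Theorems.SnLevelDesigns.stub_garnirFreeMiddle`); replaced by the import as soon as the farm snapshot has built that module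
  sorry

/-- **K5 `AlphabetWall`** (registered stub, LEAD c3 RESHAPE 7; size M–L; LANDED p117603, both cases `n' ≤ n` and `n < n'`): the pair wall ON A SUPPORT. If every
element of `X` and of `Y` fixes all points `≥ n'` (so `X, Y` live in the Young factor `𝔖_{[0,n')} × 1`), `Z ≠ ∅` and `(X, Y, Z)` is
`k`-token separated in `𝔖ₙ`, then `|X|·|Y| ≤ D_k(n')` — the level-`k` dimension of the SMALL symmetric group. Proof: as in the landed
wall `Negative.card_X_mul_card_Y_le_finrank` the translates `w ↦ f_{x₀,z₁}(w · y⁻¹ z₁)` of the separators of one column form a dual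
family to the points `x⁻¹y ∈ 𝔖_{[0,n')} × 1`, so `|X||Y| ≤ dim (T_k(𝔖ₙ)|_{𝔖_{[0,n')}×1})`; and a `k`-token function of `𝔖ₙ` restricted
to `𝔖_{[0,n')} × 1` is a `k`-token function of `𝔖_{n'}` (a token placed at a point `≥ n'` reads a constant; re-index the table with a
dummy coordinate — or `n' = 0`, where both sides are `≤ 1`), whose space has dimension `≤ D_k(n')`
(`LevelGradedCohnUmansTokenWall.finrank_tokenSpace_le` at `n'`). CONSEQUENCE (lead c3 note `TwoSetGeneric-c3.md` §3): every design whose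
three sets are supported on `A ∪ H`, `C ∪ H`, `B ∪ H` for pairwise disjoint letter blocks (`|A| = |B| = |C| = m`, `n = 3m + k`; the hub
families of K3/K4 and every "three-alphabet" architecture) has all three pair walls inside Young factors `𝔖_{2m+k}`, hence
`V ≤ D_k(2m+k)^{3/2} ≈ (8/27)^k · D_k(n)^{3/2}` — exponentially under the wall whatever the pattern classes: disjoint alphabets are
dead by counting (by conjugation invariance of `T_k` the support may be any `n'`-set). -/
def AlphabetWall : Prop :=
  ∀ (n k n' : ℕ) (X Y Z : Finset (Equiv.Perm (Fin n))),
    (∀ x ∈ X, ∀ i : Fin n, n' ≤ (i : ℕ) → x i = i) → (∀ y ∈ Y, ∀ i : Fin n, n' ≤ (i : ℕ) → y i = i) →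
      Z.Nonempty → KTokenSeparated n k X Y Z → X.card * Y.card ≤ levelDim n' k

/-- Registered stub K5 (statement = `AlphabetWall`, tree-only vocabulary). -/
theorem stub_alphabetWall :
    ∀ (n k n' : ℕ) (X Y Z : Finset (Equiv.Perm (Fin n))),
      (∀ x ∈ X, ∀ i : Fin n, n' ≤ (i : ℕ) → x i = i) → (∀ y ∈ Y, ∀ i : Fin n, n' ≤ (i : ℕ) → y i = i) →
        Z.Nonempty →
          (∀ x₀ ∈ X, ∀ z₀ ∈ Z, ∃ c : (Fin k → Fin n) → (Fin k → Fin n) → ℂ,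
              ∀ x ∈ X, ∀ y ∈ Y, ∀ y' ∈ Y, ∀ z ∈ Z,
                (∑ p : Fin k → Fin n, c p (⇑(x⁻¹ * y * y'⁻¹ * z) ∘ p)) = if x = x₀ ∧ y = y' ∧ z = z₀ then 1 else 0) →
            X.card * Y.card ≤
              ∑ μ : Nat.Partition n', if n' - k ≤ μ.parts.sup then
                Literature.NumberTheory.DiophantineGeometry.numStandardTableaux μ ^ 2 else 0 := by
  -- LANDED p117603 (`Theorems.SnLevelDesigns.stub_alphabetWall`); replaced by the import as soon as the farm snapshot has built that module
  sorry

/-- **F1 `FullBudgetTransfer`** (registered stub, LEAD c3 RESHAPE 7; size S–M; LANDED p117355; first kernel-checked by triage r1-1/r1-3 as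
evidence `LiftIdle.lean`, never landed): the crux is IMPLIED by the positive form of Blasiak–Church–Cohn–Grochow–Umans 2017 §6's open
question ("a TPP construction in `𝔖_k` with sets of cardinality `k!^{1/2}/e^{o(√k)}`"), in Cohn–Umans budget form: if for every `ε > 0`
some `𝔖_k` carries a TPP triple (CKSU quotient form `x₀x⁻¹ · yy'⁻¹ · zz₀⁻¹ = 1 ⇒ x = x₀, y = y', z = z₀`) beating the FULL budget
`Σ_{ν ⊢ k} (f^ν)^{2+ε} < (|X||Y||Z|)^{(2+ε)/3}`, then `SnLevelDesigns`. Proof: `n := k`, level `k = n`: the token function with table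
`c p q := [p = id ∧ q = x₀⁻¹z₀]` is the indicator of `g = x₀⁻¹z₀`, which by TPP is the crux's `0/1` pattern; and `n - k = 0 ≤ μ₁` makes
the graded budget the full one. So the crux sits between two open problems: FullBudget ⇒ crux ⇒ `ω = 2` (route assembly); BCCGU17
Thm 34: every Young-subgroup triple loses `e^{ck - d√k log k}`, all known constructions lose `e^{-Ω(k)}`.
[cite: BlasiakChurchCohnGrochowUmans2017 §6 (arXiv:1712.02302 p. 9–11); CohnUmans2003 (triangle construction)] -/
def FullBudgetTransfer : Prop :=
  (∀ ε : ℝ, 0 < ε → ∃ (k : ℕ) (X Y Z : Finset (Equiv.Perm (Fin k))),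
      (∀ x₀ ∈ X, ∀ x ∈ X, ∀ y ∈ Y, ∀ y' ∈ Y, ∀ z ∈ Z, ∀ z₀ ∈ Z,
          x₀ * x⁻¹ * (y * y'⁻¹) * (z * z₀⁻¹) = 1 → x = x₀ ∧ y = y' ∧ z = z₀) ∧
        (∑ ν : Nat.Partition k, (numStandardTableaux ν : ℝ) ^ (2 + ε)) <
          ((X.card * Y.card * Z.card : ℕ) : ℝ) ^ ((2 + ε) / 3)) →
    ∀ ε : ℝ, 0 < ε → ∃ (n k : ℕ) (X Y Z : Finset (Equiv.Perm (Fin n))), KTokenSeparated n k X Y Z ∧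
      (∑ μ : Nat.Partition n,
          if n - k ≤ μ.parts.sup then (numStandardTableaux μ : ℝ) ^ (2 + ε) else 0) <
        ((X.card * Y.card * Z.card : ℕ) : ℝ) ^ ((2 + ε) / 3)

/-- Registered stub F1 (statement = `FullBudgetTransfer`, tree-only vocabulary: the conclusion is the crux unfolded). -/
theorem stub_fullBudgetTransfer :
    (∀ ε : ℝ, 0 < ε → ∃ (k : ℕ) (X Y Z : Finset (Equiv.Perm (Fin k))),
        (∀ x₀ ∈ X, ∀ x ∈ X, ∀ y ∈ Y, ∀ y' ∈ Y, ∀ z ∈ Z, ∀ z₀ ∈ Z,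
            x₀ * x⁻¹ * (y * y'⁻¹) * (z * z₀⁻¹) = 1 → x = x₀ ∧ y = y' ∧ z = z₀) ∧
          (∑ ν : Nat.Partition k, (Literature.NumberTheory.DiophantineGeometry.numStandardTableaux ν : ℝ) ^ (2 + ε)) <
            ((X.card * Y.card * Z.card : ℕ) : ℝ) ^ ((2 + ε) / 3)) →
      ∀ ε : ℝ, 0 < ε → ∃ (n k : ℕ) (X Y Z : Finset (Equiv.Perm (Fin n))),
        (∀ x₀ ∈ X, ∀ z₀ ∈ Z, ∃ c : (Fin k → Fin n) → (Fin k → Fin n) → ℂ,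
            ∀ x ∈ X, ∀ y ∈ Y, ∀ y' ∈ Y, ∀ z ∈ Z,
              (∑ p : Fin k → Fin n, c p (⇑(x⁻¹ * y * y'⁻¹ * z) ∘ p)) = if x = x₀ ∧ y = y' ∧ z = z₀ then 1 else 0) ∧
          (∑ μ : Nat.Partition n, if n - k ≤ μ.parts.sup then
              (Literature.NumberTheory.DiophantineGeometry.numStandardTableaux μ : ℝ) ^ (2 + ε) else 0) <
            ((X.card * Y.card * Z.card : ℕ) : ℝ) ^ ((2 + ε) / 3) := by
  -- LANDED p117355 (`Theorems.SnLevelDesigns.stub_fullBudgetTransfer`); replaced by the import as soon as the farm snapshot has built that module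
  sorry

/-- F1 re-folded: the full-budget `𝔖_k` question implies the crux BY NAME (kept as a separate theorem from `SnLevelDesigns_of`, whose
hypothesis is the line's construction stub; this one's hypothesis is BCCGU17's open question). -/
theorem snLevelDesigns_of_fullBudget (hF : FullBudgetTransfer)
    (h : ∀ ε : ℝ, 0 < ε → ∃ (k : ℕ) (X Y Z : Finset (Equiv.Perm (Fin k))),
      (∀ x₀ ∈ X, ∀ x ∈ X, ∀ y ∈ Y, ∀ y' ∈ Y, ∀ z ∈ Z, ∀ z₀ ∈ Z,
          x₀ * x⁻¹ * (y * y'⁻¹) * (z * z₀⁻¹) = 1 → x = x₀ ∧ y = y' ∧ z = z₀) ∧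
        (∑ ν : Nat.Partition k, (numStandardTableaux ν : ℝ) ^ (2 + ε)) <
          ((X.card * Y.card * Z.card : ℕ) : ℝ) ^ ((2 + ε) / 3)) :
    Summit.MatrixMultiplication.MatrixMultiplication.Theses.LevelGradedCohnUmans.SnLevelDesigns :=
  hF h

/-- K5 applied to the three pair walls of a design supported on three letter blocks through a common hub set, in the simplest
support form (all of `X ∪ Y` inside `𝔖_{[0,n')} × 1`): `|X|·|Y| ≤ D_k(n')`. -/
theorem card_mul_card_le_levelDim_of_support (hA : AlphabetWall) {n k n' : ℕ} {X Y Z : Finset (Equiv.Perm (Fin n))}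
    (hX : ∀ x ∈ X, ∀ i : Fin n, n' ≤ (i : ℕ) → x i = i) (hY : ∀ y ∈ Y, ∀ i : Fin n, n' ≤ (i : ℕ) → y i = i)
    (hZ : Z.Nonempty) (h : KTokenSeparated n k X Y Z) : X.card * Y.card ≤ levelDim n' k :=
  hA n k n' X Y Z hX hY hZ h

/-- **K6 `LevelDimUpper`** (registered stub, LEAD c3 RESHAPE 8; size M; LANDED p118684): the level-`k` dimension is within a constant
of its leading term from ABOVE: `levelDim n k ≤ 2·C(n,k)²·k!` for `3k ≤ n` (S5h (b) is the matching lower bound `e^{-2}C(n,k)²k! ≤ levelDim`).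
Proof: every `μ ⊢ n` with `μ₁ ≥ n - k` is `(μ₁, ν)` with `ν ⊢ j := n - μ₁ ≤ k` (`FirstRowPeeling.exists_sortedParts_eq_sup_cons`; the map
`μ ↦ (j, ν)` is injective since `μ.sortedParts = μ₁ :: ν.sortedParts`), and `f^μ ≤ C(n,j)·f^ν` (`FirstRowPeeling.numStandardTableaux_le_choose_mul`,
landed p80617); so `levelDim n k ≤ Σ_{j ≤ k} C(n,j)² Σ_{ν ⊢ j}(f^ν)² = Σ_{j ≤ k} C(n,j)² j!` (`VershikKerovMaxDegreeProofs.sum_sq_numStandardTableaux`),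
and for `3k ≤ n`, `C(n,k-i)²(k-i)! ≤ 4^{-i}·C(n,k)²k!` (`C(n,k-i)/C(n,k) = Π_{l<i}(k-l)/(n-k+l+1) ≤ 2^{-i}`), so the sum is `≤ (4/3)·C(n,k)²k!`.
Needed by every NearWall-type statement to convert a count `|X||Z| ≥ (1-o(1))·C(n,k)(n)_k` into the `levelDim` form (e.g. the twisted
pairs of `TwoSetGeneric-c3.md` §5). [cite: FultonYoungTableaux1997 §7.2; FrameRobinsonThrallCJM1954 Thm 1] -/
def LevelDimUpper : Prop :=
  ∀ (n k : ℕ), 3 * k ≤ n → levelDim n k ≤ 2 * n.choose k ^ 2 * k.factorial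

/-- Registered stub K6 (statement = `LevelDimUpper`, tree-only vocabulary). -/
theorem stub_levelDimUpper :
    ∀ (n k : ℕ), 3 * k ≤ n →
      (∑ μ : Nat.Partition n, if n - k ≤ μ.parts.sup then
          Literature.NumberTheory.DiophantineGeometry.numStandardTableaux μ ^ 2 else 0) ≤
        2 * n.choose k ^ 2 * k.factorial := by
  -- LANDED p118684 (`Theorems.SnLevelDesigns.stub_levelDimUpper`); replaced by the import as soon as the farm snapshot has built that module
  sorry

/-- S5h (b) and K6 together: `e^{-2}·C(n,k)²k! ≤ D_k(n) ≤ 2·C(n,k)²k!` for `3k ≤ n`. -/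
theorem levelDim_le_two_mul (hU : LevelDimUpper) {n k : ℕ} (h : 3 * k ≤ n) :
    levelDim n k ≤ 2 * n.choose k ^ 2 * k.factorial :=
  hU n k h

/-! ## P — EXPLICIT pairs over one alphabet: the φ-twisted gadget (LEAD c3; conjecture, numerically certified k ≤ 3)

Lead c2's hub gadget `x_a = Π_i (h_i a_i)`, `z_b = Π_i (h_i b_i)` over ONE alphabet forgets a letter at every same-index coincidence
`a_i = b_i` (an element coincidence, fatal for every certificate; priced `e^{-Θ(√(k log n))}`). Twisting the x-gadget by the rotation
`φ` of the alphabet, `x_a⁻¹ := Π_i (h_i → a_i → φ(a_i) → h_i)`, records the cancelled letter at the hub (`(h_i φ(p))` survives), and with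
pattern classes forming an EXACT FACTORISATION `𝔖_k = P_A·P_B⁻¹` the product set `X⁻¹Z` is injective and SEQUENTIALLY k-identifiable
(peelable: a unitriangular certificate of token-independence, so `(X, {1}, Z)` is separated by K1) in every computed case — k = 2
(n' ≤ 12), k = 3 (n' ≤ 9); non-factorisations fail (`TwoSetGeneric-c3.md` §5; kit j019292 tests k = 4). Size `|X||Z| = C(n',k)²k!(1-O(k²/n'))`,
within an absolute constant of `D_k(n'+k)` for `n' ≥ k³` (K6 + S5h), balanced up to `|P_A|/|P_B| ∈ [1/k, k]`: `NearWallPair` CONSTRUCTIVELY,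
modulo the general peelability proof (a finite case analysis on letter-overlap patterns; generic targets are alone on their natural frame
`b` by the factorisation, the others trade `b_l` for `h_l`). Recorded here as named statements (NOT registered stubs). -/

/-- The hub point `h_i` and the letter `p` inside `Fin (n' + k)` (letters first, hubs last). -/
def hubPt (n' k : ℕ) (i : Fin k) : Fin (n' + k) := Fin.natAdd n' i

/-- The letter `p < n'` as a point of `Fin (n' + k)`. -/
def letterPt (n' k : ℕ) (p : Fin n') : Fin (n' + k) := Fin.castAdd k p

/-- The hub gadget of a word `w` (lead c2's `z`-side): the involution `Π_i (h_i w_i)`. -/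
def hubGadget (n' k : ℕ) (w : Fin k → Fin n') : Equiv.Perm (Fin (n' + k)) :=
  (List.ofFn fun i : Fin k => Equiv.swap (hubPt n' k i) (letterPt n' k (w i))).prod

/-- The φ-TWISTED gadget of a word `w` (`φ = finRotate n'`): `Π_i (h_i → w_i → φ(w_i) → h_i)`, each 3-cycle written as
`swap h_i φ(w_i) * swap h_i w_i`. This is `x⁻¹` for the `X`-side. -/
def twistGadget (n' k : ℕ) (w : Fin k → Fin n') : Equiv.Perm (Fin (n' + k)) :=
  (List.ofFn fun i : Fin k =>
    Equiv.swap (hubPt n' k i) (letterPt n' k (finRotate n' (w i))) * Equiv.swap (hubPt n' k i) (letterPt n' k (w i))).prod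

/-- The words `sel(S) ∘ α` for `S` a `k`-subset of the alphabet and `α` in a pattern class `P`. -/
def patternWords (n' k : ℕ) (P : Finset (Equiv.Perm (Fin k))) : Finset (Fin k → Fin n') :=
  ((Finset.univ.powersetCard k) ×ˢ P).attach.image fun q =>
    fun i => (q.1.1).orderEmbOfFin (Finset.mem_powersetCard.1 (Finset.mem_product.1 q.2).1).2 (q.1.2 i)

/-- `X` of the twisted pair family: inverses of the twisted gadgets of the pattern words of `P_A` whose `2k` letters `w_i, φ(w_i)` are
pairwise distinct. -/
def twistX (n' k : ℕ) (P_A : Finset (Equiv.Perm (Fin k))) : Finset (Equiv.Perm (Fin (n' + k))) :=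
  ((patternWords n' k P_A).filter fun w =>
      ((Finset.univ.image w) ∪ (Finset.univ.image fun i => finRotate n' (w i))).card = 2 * k).image
    fun w => (twistGadget n' k w)⁻¹

/-- `Z` of the twisted pair family: hub gadgets of the pattern words of `P_B`. -/
def hubZ (n' k : ℕ) (P_B : Finset (Equiv.Perm (Fin k))) : Finset (Equiv.Perm (Fin (n' + k))) :=
  (patternWords n' k P_B).image fun w => hubGadget n' k w

/-- **Conjecture `TwistPairsSeparated`** (LEAD c3; exhaustively verified for k = 2, n' ≤ 12 and k = 3, n' ≤ 9 by the peel certificate):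
for every exact factorisation `𝔖_k = P_A·P_B⁻¹` (every `σ` is `αβ⁻¹` for exactly one pair) and `n' ≥ 2k + 1`, the twisted pair family is
a `k`-token separated PAIR: `(twistX, {1}, hubZ)` separated in `𝔖_{n'+k}` — equivalently (K1) `X⁻¹Z` injective and token-independent,
of size `|X||Z| = C(n',k)²·|P_A||P_B|·(1 - O(k²/n')) = Λ_k(n')(1 - o(1))`. With K6/S5h this gives `NearWallPair`. -/
def TwistPairsSeparated : Prop :=
  ∀ (k n' : ℕ) (P_A P_B : Finset (Equiv.Perm (Fin k))), 2 * k + 1 ≤ n' →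
    (∀ σ : Equiv.Perm (Fin k), ∃! q : Equiv.Perm (Fin k) × Equiv.Perm (Fin k), q.1 ∈ P_A ∧ q.2 ∈ P_B ∧ σ = q.1 * q.2⁻¹) →
      KTokenSeparated (n' + k) k (twistX n' k P_A) {1} (hubZ n' k P_B)

/-- M1 in this file's vocabulary (the two unfoldings are syntactic). -/
theorem kTokenSeparated_iff_ev (hM : LinearCriterion) {n k : ℕ} (X Y Z : Finset (Equiv.Perm (Fin n)))
    (hY : Y.Nonempty) :
    KTokenSeparated n k X Y Z ↔
      ∀ x₀ ∈ X, ∀ z₀ ∈ Z, ev n k (x₀⁻¹ * z₀) ∉ Submodule.span ℂ (ev n k '' garbage X Y Z x₀ z₀) :=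
  hM n k X Y Z hY

/-- M3 in this file's vocabulary: a separated triple with non-empty sides has a middle difference set free of Young subgroups of
excess `≥ k + 1`. -/
theorem not_blockStab_subset_diff (hM : GarnirFreeMiddle) {n k : ℕ} {X Y Z : Finset (Equiv.Perm (Fin n))}
    {blk : Fin n → Fin n} (hexc : numBlocks blk + k + 1 ≤ n) (hX : X.Nonempty) (hZ : Z.Nonempty)
    (h : KTokenSeparated n k X Y Z) : ∃ σ ∈ blockStab blk, ∀ y ∈ Y, ∀ y' ∈ Y, σ ≠ y * y'⁻¹ := by
  by_contra hc
  refine hM n k X Y Z blk hexc hX hZ h fun σ hσ => ?_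
  by_contra hσ'
  exact hc ⟨σ, hσ, fun y hy y' hy' heq => hσ' ⟨y, hy, y', hy', heq⟩⟩


/-! ### Registered-stub aliases
`Registered.stub_X` is stub `X`'s statement under the registered stub's short name, so that the native skeleton
audit (`#h21_check_skeleton … stub_…`, run by `ledger skeleton check`) accepts the hypotheses of
`SnLevelDesigns_of` as the registered obligations (hypothesis heads are matched by name). -/
namespace Registered

/-- Statement of registered stub S1. -/
abbrev stub_garnirVanishing : Prop := GarnirVanishing
/-- Statement of registered stub S2. -/
abbrev stub_decreasingCover : Prop := DecreasingCover
/-- Statement of registered stub S3. -/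
abbrev stub_blockDescent : Prop := BlockDescent
/-- Statement of registered stub S4. -/
abbrev stub_shellInterpolation : Prop := ShellInterpolation
/-- Statement of registered stub S5h. -/
abbrev stub_firstRowHooks : Prop := FirstRowHooks
/-- Statement of registered stub S5g. -/
abbrev stub_hookGlue : Prop := HookGlue
/-- Statement of the gen-1 stub S6 (superseded by S6'). -/
abbrev stub_garnirDesigns : Prop := GarnirDesigns
/-- Statement of registered stub S5g' (LEAD RESHAPE 2). -/
abbrev stub_nearWallGlue : Prop := NearWallGlue
/-- Statement of registered stub S6' (LEAD RESHAPE 2). -/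
abbrev stub_floatingGarnirDesigns : Prop := FloatingDesigns
/-- Statement of registered stub J1 (LEAD c1 RESHAPE 3). -/
abbrev stub_topCone : Prop := TopCone
/-- Statement of registered stub J2 (LEAD c1 RESHAPE 3). -/
abbrev stub_uniformJuntaWall : Prop := UniformJuntaWall
/-- Statement of registered stub J3 (LEAD c1 RESHAPE 4). -/
abbrev stub_hostedMiddleWall : Prop := HostedMiddleWall
/-- Statement of registered stub K1 (LEAD c2 RESHAPE 5). -/
abbrev stub_xzIndependence : Prop := XZIndependence
/-- Statement of registered stub K2 (LEAD c2 RESHAPE 5). -/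
abbrev stub_twoSetCore : Prop := TwoSetCore
/-- Statement of registered stub J4 (LEAD c2 RESHAPE 5). -/
abbrev stub_floatingFrameCount : Prop := FloatingFrameCount
/-- Statement of registered stub K3 (LEAD c2 RESHAPE 5). -/
abbrev stub_hubPairs : Prop := HubPairs
/-- Statement of registered stub K4 (LEAD c2 RESHAPE 5). -/
abbrev stub_hubTriples : Prop := HubTriples
/-- Registered stub M1 under its registered name (LEAD c3 reshape 6). -/
abbrev stub_linearCriterion : Prop := LinearCriterion
/-- Registered stub M2 under its registered name (LEAD c3 reshape 6). -/
abbrev stub_middleIdentityTest : Prop := MiddleIdentityTest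
/-- Registered stub M3 under its registered name (LEAD c3 reshape 6). -/
abbrev stub_garnirFreeMiddle : Prop := GarnirFreeMiddle
/-- Registered stub K5 under its registered name (LEAD c3 reshape 7). -/
abbrev stub_alphabetWall : Prop := AlphabetWall
/-- Registered stub F1 under its registered name (LEAD c3 reshape 7). -/
abbrev stub_fullBudgetTransfer : Prop := FullBudgetTransfer
/-- Registered stub K6 under its registered name (LEAD c3 reshape 8). -/
abbrev stub_levelDimUpper : Prop := LevelDimUpper

end Registered

/-! ## Elementary facts about the vocabulary (proved) -/

theorem mem_blockStab {blk : Fin n → Fin n} {σ : Equiv.Perm (Fin n)} :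
    σ ∈ blockStab blk ↔ ∀ a, blk (σ a) = blk a := by
  simp [blockStab]

theorem one_mem_blockStab (blk : Fin n → Fin n) : (1 : Equiv.Perm (Fin n)) ∈ blockStab blk := by
  simp [blockStab]

theorem bruhatLE_refl (w : Equiv.Perm (Fin n)) : bruhatLE w w := fun _ _ => le_rfl

theorem bruhatLE_trans {u v w : Equiv.Perm (Fin n)} (h₁ : bruhatLE u v) (h₂ : bruhatLE v w) :
    bruhatLE u w := fun i j => (h₂ i j).trans (h₁ i j)

/-- Crude bound `Φ(w) ≤ n·n·n` (each of the `n` terms is `< n·n`), used to run the straightening induction on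
the co-weight `n³ - Φ`. -/
theorem posWeight_le (w : Equiv.Perm (Fin n)) : posWeight w ≤ n * (n * n) := by
  unfold posWeight
  calc ∑ i : Fin n, (i : ℕ) * ((w i : Fin n) : ℕ) ≤ ∑ _i : Fin n, n * n :=
        Finset.sum_le_sum fun i _ => Nat.mul_le_mul (le_of_lt i.isLt) (le_of_lt (w i).isLt)
    _ = n * (n * n) := by simp [Finset.sum_const, Finset.card_univ, Fintype.card_fin]

/-- Two-sided translation of token tables (bi-invariance of the `k`-token space): `f_c(a g b) = f_{c'}(g)` with
`c' p q = c (b⁻¹ ∘ p) (a ∘ q)` — reindex `p ↦ b ∘ p`.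
-- adapted from Cruxes/SnLevelDesigns/Disproof.lean `tokenFn_translate` (= landed `Negative.tokenFn_translate`) -/
theorem tokenFn_translate {n k : ℕ} (c : (Fin k → Fin n) → (Fin k → Fin n) → ℂ)
    (a b g : Equiv.Perm (Fin n)) :
    tokenFn c (a * g * b) = tokenFn (fun p q => c (⇑b⁻¹ ∘ p) (⇑a ∘ q)) g := by
  unfold tokenFn
  let e : (Fin k → Fin n) ≃ (Fin k → Fin n) := Equiv.arrowCongr (Equiv.refl (Fin k)) b
  symm
  rw [← e.sum_comp]
  refine Finset.sum_congr rfl fun p _ => ?_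
  have h1 : (⇑b⁻¹ ∘ (e p) : Fin k → Fin n) = p := by
    funext i; simp [e, Equiv.arrowCongr_apply, Equiv.Perm.inv_def]
  have h2 : (⇑a ∘ (⇑g ∘ e p) : Fin k → Fin n) = ⇑(a * g * b) ∘ p := by
    funext i; simp [e, Equiv.arrowCongr_apply]
  simp only [h1, h2]

/-! ## Garnir straightening, annihilator side (proved from the stubs) -/

/-- One Garnir step (from S1, right-coset form `a = p`, `b = 1`): if the token function `f_c` vanishes on every
PROPER rearrangement `p σ` of `p` under a block labelling of excess `≥ k+1`, it vanishes at `p`. -/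
theorem tokenFn_eq_zero_of_children (hV : GarnirVanishing) {n k : ℕ} {blk : Fin n → Fin n}
    (hexc : numBlocks blk + k + 1 ≤ n) (c : (Fin k → Fin n) → (Fin k → Fin n) → ℂ)
    (p : Equiv.Perm (Fin n)) (hch : ∀ σ ∈ blockStab blk, σ ≠ 1 → tokenFn c (p * σ) = 0) :
    tokenFn c p = 0 := by
  classical
  have hsum := hV n k blk hexc c p 1
  rw [Finset.sum_eq_single_of_mem (1 : Equiv.Perm (Fin n)) (one_mem_blockStab blk)] at hsum
  · simpa using hsum
  · intro σ hσ hne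
    rw [mul_one, hch σ hσ hne, mul_zero]

/-- **Garnir straightening ⇒ Bruhat shadow** (from S1 + S2 + S3, induction on inversions): a token function that
is `δ_t` on the Schensted shell vanishes at every `p` that is not Bruhat-above `t` — the annihilator-side,
Kazhdan–Lusztig-free proof of `Ideator3.ShadowStraightening`'s consequence for dual functionals. -/
theorem tokenFn_eq_zero_of_not_bruhatLE (hV : GarnirVanishing) (hC : DecreasingCover) (hD : BlockDescent)
    {n k : ℕ} {t : Equiv.Perm (Fin n)} {c : (Fin k → Fin n) → (Fin k → Fin n) → ℂ}
    (hc : ∀ g ∈ schenstedSet n k, tokenFn c g = if g = t then 1 else 0) :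
    ∀ p : Equiv.Perm (Fin n), ¬ bruhatLE t p → tokenFn c p = 0 := by
  classical
  -- strong induction on the co-weight `n³ - Φ(p)` (each Garnir child has strictly larger `Φ`)
  suffices h : ∀ m : ℕ, ∀ p : Equiv.Perm (Fin n),
      n * (n * n) - posWeight p < m → ¬ bruhatLE t p → tokenFn c p = 0 by
    exact fun p hp => h (n * (n * n) - posWeight p + 1) p (Nat.lt_succ_self _) hp
  intro m
  induction m with
  | zero => intro p hp; exact absurd hp (Nat.not_lt_zero _)
  | succ m ih =>
    intro p hp hnot
    by_cases hpB : p ∈ schenstedSet n k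
    · have hpt : p ≠ t := by
        rintro rfl
        exact hnot (bruhatLE_refl p)
      rw [hc p hpB, if_neg hpt]
    · obtain ⟨blk, hexc, hdec⟩ := hC n k p hpB
      refine tokenFn_eq_zero_of_children hV hexc c p fun σ hσ hσ1 => ?_
      obtain ⟨hle, hlt⟩ := hD n blk p hdec σ hσ hσ1
      have hbd := posWeight_le (p * σ)
      refine ih (p * σ) (by omega) fun htle => ?_
      exact hnot (bruhatLE_trans htle hle)

/-- **The dual functional of a target vanishes on its Garnir-avoidance set** (from S1–S3 and the interpolation
property of `c`): induction over the avoidance tree. -/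
theorem tokenFn_eq_zero_of_garnirAvoid (hV : GarnirVanishing) (hC : DecreasingCover) (hD : BlockDescent)
    {n k : ℕ} {t : Equiv.Perm (Fin n)} {c : (Fin k → Fin n) → (Fin k → Fin n) → ℂ}
    (hc : ∀ g ∈ schenstedSet n k, tokenFn c g = if g = t then 1 else 0)
    {p : Equiv.Perm (Fin n)} (hp : GarnirAvoid n k t p) : tokenFn c p = 0 := by
  induction hp with
  | @shell p hB hne => rw [hc p hB, if_neg hne]
  | @incomparable p hnot => exact tokenFn_eq_zero_of_not_bruhatLE hV hC hD hc p hnot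
  | @step p blk hexc _ ih => exact tokenFn_eq_zero_of_children hV hexc c p fun σ hσ h1 => ih σ hσ h1

/-- **Certificate theorem** (S1–S4 ⇒ `GarnirCertified → KTokenSeparated`): the dual functional `f_t` of the
target `t = x₀⁻¹z₀` (S4, `δ_t` on the shell) is the separator — it is `1` at the target quadruples and `0` at every
non-target quadruple product (all of which Garnir-avoid `t`). No separate TPP hypothesis is needed: the value is
assigned per quadruple, and a non-target quadruple producing `t` itself would need a certificate forcing
`f_t(t) = 0`, which `GarnirCertified` therefore cannot contain. -/
theorem separated_of_certified (hV : GarnirVanishing) (hC : DecreasingCover) (hD : BlockDescent)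
    (hI : ShellInterpolation) {n k : ℕ} {X Y Z : Finset (Equiv.Perm (Fin n))}
    (h : GarnirCertified n k X Y Z) : KTokenSeparated n k X Y Z := by
  classical
  obtain ⟨hkn, hT, hA⟩ := h
  intro x₀ hx₀ z₀ hz₀
  obtain ⟨c, hc⟩ := hI n k hkn (fun g => if g = x₀⁻¹ * z₀ then 1 else 0)
  refine ⟨c, fun x hx y hy y' hy' z hz => ?_⟩
  show tokenFn c (x⁻¹ * y * y'⁻¹ * z) = _
  by_cases htarget : x = x₀ ∧ y = y' ∧ z = z₀
  · obtain ⟨rfl, rfl, rfl⟩ := htarget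
    rw [if_pos ⟨rfl, rfl, rfl⟩]
    have hprod : x⁻¹ * y * y⁻¹ * z = x⁻¹ * z := by group
    rw [hprod, hc _ (hT x hx z hz), if_pos rfl]
  · rw [if_neg htarget]
    exact tokenFn_eq_zero_of_garnirAvoid hV hC hD hc (hA x₀ hx₀ z₀ hz₀ x hx y hy y' hy' z hz htarget)

/-- **Floating certificate theorem** (LEAD RESHAPE 2; S1–S4 ⇒ `FloatingCertified → KTokenSeparated`): for the
target `t` with frame `(a,b)`, `s := a t b ∈ B_k`, take the dual functional `f_s` (S4) and TRANSLATE it,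
`F(g) := f_s(a g b)` — again a `k`-token function (`tokenFn_translate`); `F(t) = f_s(s) = 1`, and for a non-target
product `p`, `F(p) = f_s(a p b) = 0` because `a p b` Garnir-avoids `s` (S1–S3 via `tokenFn_eq_zero_of_garnirAvoid`). -/
theorem separated_of_floatingCertified (hV : GarnirVanishing) (hC : DecreasingCover) (hD : BlockDescent)
    (hI : ShellInterpolation) {n k : ℕ} {X Y Z : Finset (Equiv.Perm (Fin n))}
    (h : FloatingCertified n k X Y Z) : KTokenSeparated n k X Y Z := by
  classical
  obtain ⟨hkn, hA⟩ := h
  intro x₀ hx₀ z₀ hz₀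
  obtain ⟨a, b, hs, havoid⟩ := hA x₀ hx₀ z₀ hz₀
  obtain ⟨c, hc⟩ := hI n k hkn (fun g => if g = a * (x₀⁻¹ * z₀) * b then 1 else 0)
  refine ⟨fun p q => c (⇑b⁻¹ ∘ p) (⇑a ∘ q), fun x hx y hy y' hy' z hz => ?_⟩
  show tokenFn (fun p q => c (⇑b⁻¹ ∘ p) (⇑a ∘ q)) (x⁻¹ * y * y'⁻¹ * z) = _
  rw [← tokenFn_translate]
  by_cases htarget : x = x₀ ∧ y = y' ∧ z = z₀
  · obtain ⟨rfl, rfl, rfl⟩ := htarget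
    rw [if_pos ⟨rfl, rfl, rfl⟩]
    have hprod : a * (x⁻¹ * y * y⁻¹ * z) * b = a * (x⁻¹ * z) * b := by group
    rw [hprod, hc _ hs, if_pos rfl]
  · rw [if_neg htarget]
    exact tokenFn_eq_zero_of_garnirAvoid hV hC hD hc (havoid x hx y hy y' hy' z hz htarget)

/-- The gen-1 certificate is the frame `a = b = 1` of the floating one. -/
theorem floatingCertified_of_garnirCertified {n k : ℕ} {X Y Z : Finset (Equiv.Perm (Fin n))}
    (h : GarnirCertified n k X Y Z) : FloatingCertified n k X Y Z := by
  obtain ⟨hkn, hT, hA⟩ := h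
  refine ⟨hkn, fun x₀ hx₀ z₀ hz₀ => ⟨1, 1, ?_, fun x hx y hy y' hy' z hz hne => ?_⟩⟩
  · simpa using hT x₀ hx₀ z₀ hz₀
  · simpa using hA x₀ hx₀ z₀ hz₀ x hx y hy y' hy' z hz hne

/-- `k^C ≤ e^{δ√k}` eventually (from `e^x ≥ x^{2C+2}/(2C+2)!` at `x = δ√k`). -/
theorem pow_le_exp_sqrt_eventually (C : ℕ) {δ : ℝ} (hδ : 0 < δ) :
    ∃ k₁ : ℕ, ∀ k : ℕ, k₁ ≤ k → (k : ℝ) ^ C ≤ Real.exp (δ * Real.sqrt (k : ℝ)) := by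
  set K : ℝ := ((2 * C + 2).factorial : ℝ) / δ ^ (2 * C + 2) with hK
  refine ⟨⌈K⌉₊ + 1, fun k hk => ?_⟩
  have hk0 : (0 : ℝ) ≤ k := Nat.cast_nonneg _
  have hkK : K ≤ k := (Nat.le_ceil K).trans (by exact_mod_cast (by omega : ⌈K⌉₊ ≤ k))
  have hx : 0 ≤ δ * Real.sqrt k := mul_nonneg hδ.le (Real.sqrt_nonneg _)
  have h := Real.pow_div_factorial_le_exp _ hx (2 * C + 2)
  have hsq : (δ * Real.sqrt k) ^ (2 * C + 2) = δ ^ (2 * C + 2) * (k : ℝ) ^ (C + 1) := by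
    rw [mul_pow]
    congr 1
    rw [show 2 * C + 2 = (C + 1) * 2 by ring, pow_mul', Real.sq_sqrt hk0]
  have hfpos : (0 : ℝ) < ((2 * C + 2).factorial : ℝ) := by positivity
  have hδpow : 0 < δ ^ (2 * C + 2) := pow_pos hδ _
  have hKk : ((2 * C + 2).factorial : ℝ) ≤ k * δ ^ (2 * C + 2) := by
    have := hkK; rw [hK, div_le_iff₀ hδpow] at this; linarith
  calc (k : ℝ) ^ C = ((2 * C + 2).factorial : ℝ) * (k : ℝ) ^ C / ((2 * C + 2).factorial : ℝ) := by
        field_simp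
    _ ≤ (k * δ ^ (2 * C + 2)) * (k : ℝ) ^ C / ((2 * C + 2).factorial : ℝ) := by gcongr
    _ = (δ * Real.sqrt k) ^ (2 * C + 2) / ((2 * C + 2).factorial : ℝ) := by rw [hsq]; ring
    _ ≤ Real.exp (δ * Real.sqrt k) := h

/-- The gen-1 target implies the reshaped one: `GarnirDesigns → FloatingDesigns` (fixed frame is a frame; `k^C ≤ e^{δ√k}`
and `k³ ≥ 3k` for `k` large). So every negative/positive result about S6' bears on S6 as registered before. -/
theorem floatingDesigns_of_garnirDesigns (h : GarnirDesigns) : FloatingDesigns := by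
  obtain ⟨C, hC⟩ := h
  intro δ hδ k₀
  obtain ⟨k₁, hk₁⟩ := pow_le_exp_sqrt_eventually C hδ
  obtain ⟨k, hk, n, X, Y, Z, hn, hcert, hV⟩ := hC (max (max k₀ k₁) 3)
  have hk₀ : k₀ ≤ k := le_trans (le_trans (le_max_left _ _) (le_max_left _ _)) hk
  have hk₁' : k₁ ≤ k := le_trans (le_trans (le_max_right _ _) (le_max_left _ _)) hk
  have hk3 : 3 ≤ k := le_trans (le_max_right _ _) hk
  refine ⟨k, hk₀, n, X, Y, Z, ?_, floatingCertified_of_garnirCertified hcert, hV.trans ?_⟩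
  · have h3 : 3 * k ≤ k ^ 3 :=
      calc 3 * k ≤ k * k := Nat.mul_le_mul_right k hk3
        _ ≤ k * k * k := Nat.le_mul_of_pos_right _ (by omega)
        _ = k ^ 3 := by ring
    exact h3.trans hn
  · exact mul_le_mul_of_nonneg_right (hk₁ k hk₁') (Nat.cast_nonneg _)

/-- **The KL line's certificate is the depth-0 case.** The hypotheses of `Ideator3.ShadowCertificate` (card
kl-schensted-certificate ≈ lis-bruhat-shield: targets in the shell; every non-target product differs from the target
and is in the shell or not Bruhat-above the target) give `GarnirCertified` using only the constructors
`shell`/`incomparable` — so S6 is implied by (the wall form of) that line's `ShadowTPP`, never harder. -/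
theorem garnirCertified_of_shadow {n k : ℕ} (hkn : k ≤ n) {X Y Z : Finset (Equiv.Perm (Fin n))}
    (hT : ∀ x ∈ X, ∀ z ∈ Z, x⁻¹ * z ∈ schenstedSet n k)
    (hS : ∀ x₀ ∈ X, ∀ z₀ ∈ Z, ∀ x ∈ X, ∀ y ∈ Y, ∀ y' ∈ Y, ∀ z ∈ Z, ¬ (x = x₀ ∧ y = y' ∧ z = z₀) →
        x⁻¹ * y * y'⁻¹ * z ≠ x₀⁻¹ * z₀ ∧
        (x⁻¹ * y * y'⁻¹ * z ∈ schenstedSet n k ∨ ¬ bruhatLE (x₀⁻¹ * z₀) (x⁻¹ * y * y'⁻¹ * z))) :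
    GarnirCertified n k X Y Z :=
  ⟨hkn, hT, fun x₀ hx₀ z₀ hz₀ x hx y hy y' hy' z hz hne =>
    (hS x₀ hx₀ z₀ hz₀ x hx y hy y' hy' z hz hne).elim fun hne' h =>
      h.elim (fun hB => GarnirAvoid.shell hB hne') (fun hnot => GarnirAvoid.incomparable hnot)⟩

/-! ## The card's kill-test (necessary direction; proved from S1 alone) -/

/-- **Kill-test** (card §(2), design-side form of the Disproof's coset obstruction, all block shapes): if the middle
set contains a full coset `y₁ · blockStab blk` of a Young subgroup of excess `≥ k+1` (e.g. `Sym` of `k+2` points, or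
`k+1` disjoint transpositions) then NO target is separated: the quadruples `(x₀, y₁σ, y₁, z₀)` produce the two-sided
Garnir coset `(x₀⁻¹y₁)·S_B·(y₁⁻¹z₀)` through the target, on which every token function has signed sum `0` (S1)
while the required values have signed sum `1`. -/
theorem not_separated_of_coset_subset (hV : GarnirVanishing) {n k : ℕ} {blk : Fin n → Fin n}
    (hexc : numBlocks blk + k + 1 ≤ n) {X Y Z : Finset (Equiv.Perm (Fin n))} {y₁ : Equiv.Perm (Fin n)}
    (hy₁ : y₁ ∈ Y) (hcos : ∀ σ ∈ blockStab blk, y₁ * σ ∈ Y) (hX : X.Nonempty) (hZ : Z.Nonempty) :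
    ¬ KTokenSeparated n k X Y Z := by
  classical
  obtain ⟨x₀, hx₀⟩ := hX
  obtain ⟨z₀, hz₀⟩ := hZ
  intro hsep
  obtain ⟨c, hc⟩ := hsep x₀ hx₀ z₀ hz₀
  have hval : ∀ σ ∈ blockStab blk,
      ((Equiv.Perm.sign σ : ℤ) : ℂ) * tokenFn c (x₀⁻¹ * y₁ * σ * (y₁⁻¹ * z₀)) =
        if σ = 1 then 1 else 0 := by
    intro σ hσ
    have h := hc x₀ hx₀ (y₁ * σ) (hcos σ hσ) y₁ hy₁ z₀ hz₀
    have hrw : x₀⁻¹ * (y₁ * σ) * y₁⁻¹ * z₀ = x₀⁻¹ * y₁ * σ * (y₁⁻¹ * z₀) := by group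
    rw [hrw] at h
    change tokenFn c (x₀⁻¹ * y₁ * σ * (y₁⁻¹ * z₀)) = _ at h
    rw [h]
    by_cases h1 : σ = 1
    · subst h1
      simp
    · have hne : ¬ (x₀ = x₀ ∧ y₁ * σ = y₁ ∧ z₀ = z₀) := by
        rintro ⟨-, h2, -⟩
        apply h1
        have h3 : y₁ * σ = y₁ * 1 := by rw [mul_one]; exact h2
        exact mul_left_cancel h3
      rw [if_neg hne, if_neg h1, mul_zero]
  have hsum := hV n k blk hexc c (x₀⁻¹ * y₁) (y₁⁻¹ * z₀)
  rw [Finset.sum_congr rfl hval, Finset.sum_ite_eq' (blockStab blk) (1 : Equiv.Perm (Fin n))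
    (fun _ => (1 : ℂ)), if_pos (one_mem_blockStab blk)] at hsum
  exact one_ne_zero hsum

/-- In particular the registered construction stub S6' forces near-wall independent product pairs (S1–S4 landed). -/
theorem nearWallPair_of_floatingDesigns (hK : TwoSetCore) (h : FloatingDesigns) : NearWallPair :=
  nearWallPair_of_nearWall hK (fun _ _ _ _ _ hc => separated_of_floatingCertified
    stub_garnirVanishing stub_decreasingCover stub_blockDescent stub_shellInterpolation hc) h

/-- … and so does the junta sub-target. -/
theorem nearWallPair_of_juntaDesigns (hK : TwoSetCore) (h : NearWall JuntaSeparated) : NearWallPair :=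
  nearWallPair_of_nearWall hK (fun _ _ _ _ _ hJ => separated_of_juntaSeparated hJ) h

/-! ## The composition (proved): S1 S2 S3 S4 S5h (LANDED) → S5g' → S6' → crux, BY NAME -/

/-- **The skeleton closes the crux modulo the ONE registered open stub S6'** (LEAD RESHAPE 2; import form LEAD c2): the landed
NearWall glue S5g' at `P := FloatingCertified`, fed with the landed S5h and the family S6', yields for the given `ε` a floating-certified
`(n, k, X, Y, Z)` with the budget inequality; the landed S1–S4 turn the floating certificate into the crux's
separation clause (`separated_of_floatingCertified`; `KTokenSeparated` is that clause definitionally). -/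
theorem SnLevelDesigns_of (h₆ : Registered.stub_floatingGarnirDesigns) :
    Summit.MatrixMultiplication.MatrixMultiplication.Theses.LevelGradedCohnUmans.SnLevelDesigns := by
  intro ε hε
  obtain ⟨n, k, X, Y, Z, hcert, hlt⟩ := stub_nearWallGlue stub_firstRowHooks FloatingCertified h₆ ε hε
  exact ⟨n, k, X, Y, Z, separated_of_floatingCertified stub_garnirVanishing stub_decreasingCover
    stub_blockDescent stub_shellInterpolation hcert, hlt⟩

/-- The polynomial-slack composition of reshape 1, now a THEOREM (all six gen-1 provable stubs landed):
`GarnirDesigns → SnLevelDesigns` — the gen-1 target closes the crux outright (an `example`, so that `SnLevelDesigns_of` is the only NAMED theorem concluding the crux; cite `floatingDesigns_of_garnirDesigns` + `SnLevelDesigns_of`). -/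
example (h₆ : GarnirDesigns) :
    Summit.MatrixMultiplication.MatrixMultiplication.Theses.LevelGradedCohnUmans.SnLevelDesigns := by
  intro ε hε
  obtain ⟨n, k, X, Y, Z, hcert, hlt⟩ := stub_hookGlue stub_firstRowHooks GarnirCertified h₆ ε hε
  exact ⟨n, k, X, Y, Z, separated_of_certified stub_garnirVanishing stub_decreasingCover stub_blockDescent
    stub_shellInterpolation hcert, hlt⟩

/-- `NearWall JuntaSeparated →` the crux, DIRECTLY (no straightening: coset indicators are token functions; the landed
S5h + S5g' supply the budget inequality) — the cleanest construction target of the whole crux chain. Stated with the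
crux UNFOLDED (`KTokenSeparated` is its separation clause verbatim), so that `SnLevelDesigns_of` stays the file's only
theorem concluding the crux by name; `example` below re-folds it. -/
theorem crux_of_juntaDesigns (h : NearWall JuntaSeparated) :
    ∀ ε : ℝ, 0 < ε → ∃ (n k : ℕ) (X Y Z : Finset (Equiv.Perm (Fin n))), KTokenSeparated n k X Y Z ∧
      (∑ μ : Nat.Partition n,
          if n - k ≤ μ.parts.sup then (numStandardTableaux μ : ℝ) ^ (2 + ε) else 0) <
        ((X.card * Y.card * Z.card : ℕ) : ℝ) ^ ((2 + ε) / 3) := by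
  intro ε hε
  obtain ⟨n, k, X, Y, Z, hJ, hlt⟩ := stub_nearWallGlue stub_firstRowHooks JuntaSeparated h ε hε
  exact ⟨n, k, X, Y, Z, separated_of_juntaSeparated hJ, hlt⟩

example (h : NearWall JuntaSeparated) :
    Summit.MatrixMultiplication.MatrixMultiplication.Theses.LevelGradedCohnUmans.SnLevelDesigns :=
  crux_of_juntaDesigns h


/-- How the closed proof is obtained once the two open stubs land (an `example`, so that `SnLevelDesigns_of` is the
only hypothesis-carrying theorem of this file concluding the crux). -/
example : Summit.MatrixMultiplication.MatrixMultiplication.Theses.LevelGradedCohnUmans.SnLevelDesigns :=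
  SnLevelDesigns_of stub_floatingGarnirDesigns

end Summit.MatrixMultiplication.MatrixMultiplication.Cruxes.SnLevelDesigns.GarnirAnnihilator

end
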